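import Literature.Analysis.SpecialFunctions.GammaVerticalBounds
import Literature.NumberTheory.ConnesConsani2021.QuasiInnerArchResidues
import HarnessLib

/-!
# Connes–Consani 2021 (JNT) §2 — residue calculus of `κ = ρ_∞ ∘ ψ` on the disc: the uniform bound for `ρ_∞` on
# `ℂ₋`, the principal parts of `κ`, Cauchy's theorem on the circles `|v| = r_m` (toolkit for Prop. 2.4)

LINE 1 — LABEL: RH-FREE corpus literature (function theory of the archimedean ratio of local factors
`ρ_∞ = Γ_ℝ(z)/Γ_ℝ(1−z)` on the left half-plane `ℂ₋` and of `κ = ρ_∞ ∘ ψ` on the unit disc; no positivity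
statement, no statement about zeros of `ζ`); bears_on: W-C/W-P (sequel typing, no leaf/binder role);
WHAT THIS IS NOT: any claim about RH — nothing in this file bears on the truth of RH.

Source: A. Connes, C. Consani, *Quasi-inner functions and local factors*, J. Number Theory **226** (2021)
139–167 = arXiv:2008.10974 [bib: `ConnesConsani2021QuasiInner`]; locators are arXiv tex chunks `pNNNN:Lnn` of
the held text `paper:arxiv-2008.10974` (page-read for this file: §2, p0005:L1–L143 and Prop. 2.4 with its
proof, p0006:L87–p0007:L8).  Companion of `QuasiInnerLocalFactors.lean` (cell rh-crit/cc seat t17: statements of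
§2–§3, `display_aminusk`, `thm_2_1`, `thm_2_3`, `prop_2_4` as named facts), `QuasiInnerArchFromAminusk.lean` (t17:
PROVED reductions) and `QuasiInnerArchResidues.lean` (t17 g2: `display_aminusk_holds` — the proof of record, along
the printed rectangles `C_{R,m}` — whose `differentiableAt_rhoArch` is REUSED here); written by seat rh-crit-cc-t16
(g3).  THEOREMS ONLY (no `def`, no new named fact).  Purpose: the DISC-side machinery of the `C^∞(S¹) + H^∞(𝒰)`
decomposition of Prop. 2.4 («we isolate the pole part of ρ_∞ … πκ … κ − πκ holomorphic in 𝒰 … bounded»,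
p0006:L91–p0007:L8) — uniform bound, principal parts, contours inside the disc — and (section E) the DISCHARGE
`prop_2_4_holds : prop_2_4` of the named fact `QuasiInnerLocalFactors.prop_2_4` (net debt −1).  (Composing
`fourierCoeff_kappaArch_eq_circleIntegral`, `tendsto_circleIntegral_kappaArch`, `circleIntegral_kappaArch_mul_pow` and
`hasSum_archNegCoeff` gives display «aminusk» again in ten lines; that second proof is not restated here — the
tree's theorem is `display_aminusk_holds`.)

## Content and proof architecture (the printed residue computation, p0005:L25–L122, packaged on the disc)

Print computes `a_{−k} = (2πi)⁻¹∮_{S¹} κ(v)v^{k−1}dv` by Cauchy's residue theorem on rectangles `C_{R,m}` in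
the `z`-plane (`z = ψ(v)`), controlling `ρ_∞` on the far side `Re z = ½ − 2m` by the functional equation and
on horizontal sides by «modulus ≤ 1 for Im z > 7», then summing the residues at the simple poles `z = −2n`
(`Γ(z/2) = 2(−1)^n/(Γ(n+1)(z+2n)) + O(1)`).  We follow the same skeleton with Mathlib's disc Cauchy–Goursat
theorem instead of rectangles:

* **A. The uniform bound** (`exists_norm_rhoArch_le`): `|ρ_∞(z)| ≤ C` for `Re z ≤ ½` at distance `≥ δ` from `2ℤ`.
  From `ρ_∞(z) = (2π)^{1−z}/(2 sin(πz/2)Γ(1−z))` (reflection + duplication, `rhoArch_eq_div_sin`), Euler's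
  product `Γ(x)²/|Γ(x+iy)|² = ∏(1+y²/(x+j)²)` (tree: `GammaVert.tendsto_prod_one_add_div_sq`) monotone in `x`, the
  reflection value `|Γ(½+iy)|² = π/cosh(πy)` (tree: `GammaVert.norm_sq_Gamma_half`) giving
  `Γ(x)² ≤ cosh(πy)|Γ(x+iy)|²` for `x ≥ ½`, `cosh(π Im z) ≤ 1 + 2|sin(πz/2)|²`, a Jordan-type lower bound for
  `|sin(πz/2)|` off `2ℤ`, and `(2π)^x/Γ(x) ≤ 2(2π)^8`.
* **B. The poles** (`exists_tendsto_rhoArch_sub_pole`, `exists_tendsto_kappaArch_sub_pole`): `ρ_∞` has a simple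
  pole at `−2n` with residue `(−1)^n 2(2π)^{2n}/(2n)!` (= print's `(−1)^n 2π^{2n+½}/(Γ(n+1)Γ(n+½))` by Legendre's
  duplication), transported to the disc through `1/(ψ(v)+2n) = (−8/(4n+3)²)/(v − x(n)) + 2/(4n+3)`: `κ` has a simple
  pole at `x(n) = 1 − 4/(4n+3)` with residue `α(n)` (`alphaArch_eq`: the printed coefficient in closed form).
* **C. The contours**: the circles `|v| = r_m`, `r_m = (4m+1)/(4m+5) = ψ⁻¹(−2m−1)` (`x(m) < r_m < x(m+1)`), whose
  `ψ`-images stay at distance `≥ 1/5` from `2ℤ` (`dist_cayley_two_mul_int_ge`).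
* **D. Assembly**: Cauchy–Goursat on `|v| ≤ r_m` for `κ(v)v^k − Σ_{n≤m} α(n)x(n)^k/(v − x(n))` (continuous across the
  poles) gives `∮_{|v|=r_m} κ v^k = 2πi Σ_{n≤m} α(n)x(n)^k` (`circleIntegral_kappaArch_mul_pow`); bounded convergence
  `m → ∞` (`tendsto_circleIntegral_kappaArch`) and `a_{−(k+1)} = (2πi)⁻¹∮_{|v|=1} κ v^k`
  (`fourierCoeff_kappaArch_eq_circleIntegral`) recover display «aminusk» (not restated; see above).
* **E. Proposition 2.4** (`prop_2_4_holds`): with the pole part `G(v) := Σ_n α(n)/(v − x(n))` (print's `πκ` up to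
  the additive constant `Σ_n Res_n·2/(4n+3)`, p0006:L91–L104): `c(x) := G(e^{2πix})` is `C^∞` and `1`-periodic
  (`contDiff_poleSum_circle`: termwise `‖D^k(α(n)/(e^{2πix} − x(n)))‖ ≤ |α(n)|(2π)^k k!/(1 − |x(n)|)^{k+1}` via the
  geometric expansion, summed with `Σ_n |α(n)|(4n+3)^{k+1} < ∞` — print: «the series of m-th derivatives of the
  terms … is absolutely convergent», p0006:L104–p0007:L8); `h := κ − G` regularised at the poles is holomorphic in
  the disc (removable singularities, `exists_tendsto_kappaArch_sub_poleSum`), bounded (maximum modulus on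
  `‖v‖ ≤ r_m` with A–C: print «k(v) := κ(v) − πκ(v) which is by construction holomorphic in 𝒰 … it is bounded
  and thus belongs to H^∞(𝒰)», p0007:L23), and has the radial limits `κ(e^{2πix}) − c(x)` at every `x ∉ ℤ` by
  continuity («the non-tangential limits … are given except at v = 1 by κ − πκ», p0007:L23).

Deviation from print, declared: disc contours instead of the rectangles `C_{R,m}`; the horizontal-side estimate
«|ρ_∞| ≤ 1 for Im z > 7» (p0005:L59–L60) is replaced by the uniform bound A (same role); in E the boundedness of
`k = κ − πκ` is obtained directly from the maximum modulus principle on the discs `‖v‖ ≤ r_m` (uniform circle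
bounds A–C and `norm_poleSum_le_of_norm_eq`) instead of the printed route «b_{−k} = a_{−k} ⇒ k ∈ H²(𝒰) ⇒ Cauchy
integral of bounded boundary values» ([Rudin] Thms 17.11/17.12, p0007:L23) — same statement, shorter in Mathlib.

Nothing in this file bears on the truth of RH.
-/

noncomputable section

open _root_.MeasureTheory _root_.Complex AddCircle Filter Set Metric
open scoped Real ENNReal InnerProductSpace Topology ComplexConjugate

namespace Literature.NumberTheory.ConnesConsani2021

namespace QuasiInner

open Literature.Analysis.SpecialFunctions in
/-- `Γ(x)² ≤ cosh(πy) · |Γ(x+iy)|²` for `x ≥ 1/2`. [folklore] -/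
private theorem real_Gamma_sq_le_cosh_mul_norm_sq {x : ℝ} (hx : 1 / 2 ≤ x) (y : ℝ) :
    Real.Gamma x ^ 2 ≤ Real.cosh (π * y) * ‖Complex.Gamma (x + y * I)‖ ^ 2 := by
  have hx0 : 0 < x := by linarith
  have h1 := GammaVert.tendsto_prod_one_add_div_sq hx0 y
  have h2 := GammaVert.tendsto_prod_one_add_div_sq (by norm_num : (0:ℝ) < 1 / 2) y
  have hle : ∀ n : ℕ, (∏ j ∈ Finset.range (n + 1), (1 + y ^ 2 / (x + j) ^ 2)) ≤
      ∏ j ∈ Finset.range (n + 1), (1 + y ^ 2 / (1 / 2 + j) ^ 2) := by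
    intro n
    apply Finset.prod_le_prod
    · intro j _; positivity
    · intro j _
      have hj : (0:ℝ) ≤ j := Nat.cast_nonneg j
      have hden : (0:ℝ) < (1 / 2 + j) ^ 2 := by positivity
      have hmono : (1 / 2 + (j:ℝ)) ^ 2 ≤ (x + j) ^ 2 := by
        apply pow_le_pow_left₀ (by positivity); linarith
      have := div_le_div_of_nonneg_left (sq_nonneg y) hden hmono
      linarith
  have hlim := le_of_tendsto_of_tendsto' h1 h2 hle
  have hhalf : Real.Gamma (1 / 2) ^ 2 / ‖Complex.Gamma (((1 / 2 : ℝ) : ℂ) + y * I)‖ ^ 2 =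
      Real.cosh (π * y) := by
    rw [GammaVert.Real_Gamma_half_sq, show (((1 / 2 : ℝ) : ℂ)) = 1 / 2 by push_cast; ring,
      GammaVert.norm_sq_Gamma_half]
    have hc : 0 < Real.cosh (π * y) := Real.cosh_pos _
    field_simp
  rw [hhalf] at hlim
  have hpos : 0 < ‖Complex.Gamma (x + y * I)‖ ^ 2 := by
    have := GammaVert.Gamma_ne_zero_of_pos hx0 y; positivity
  rwa [div_le_iff₀ hpos] at hlim

/-- `|sin z|² = sin²(Re z) + sinh²(Im z)`. [folklore] -/
private theorem norm_sin_sq (z : ℂ) : ‖Complex.sin z‖ ^ 2 = Real.sin z.re ^ 2 + Real.sinh z.im ^ 2 := by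
  have hz : z = (z.re : ℂ) + (z.im : ℂ) * I := (re_add_im z).symm
  conv_lhs => rw [hz]
  rw [Complex.sin_add_mul_I, ← ofReal_sin, ← ofReal_cosh, ← ofReal_cos, ← ofReal_sinh,
    show ((Real.sin z.re : ℂ)) * (Real.cosh z.im : ℂ) + (Real.cos z.re : ℂ) * (Real.sinh z.im : ℂ) * I
      = ((Real.sin z.re * Real.cosh z.im : ℝ) : ℂ) + ((Real.cos z.re * Real.sinh z.im : ℝ) : ℂ) * I by
      push_cast; ring,
    Complex.sq_norm, Complex.normSq_add_mul_I]
  have h1 := Real.cosh_sq z.im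
  have h2 := Real.sin_sq_add_cos_sq z.re
  linear_combination (Real.sin z.re ^ 2) * h1 + (Real.sinh z.im ^ 2) * h2

/-- RH-FREE. `Re(πz/2) = π Re(z)/2`. [folklore] -/
private theorem re_pi_mul_div_two (z : ℂ) : ((π : ℂ) * z / 2).re = π * z.re / 2 := by
  simp [Complex.mul_re]

/-- RH-FREE. `Im(πz/2) = π Im(z)/2`. [folklore] -/
private theorem im_pi_mul_div_two (z : ℂ) : ((π : ℂ) * z / 2).im = π * z.im / 2 := by
  simp [Complex.mul_im]

/-- `cosh(π Im z) ≤ 1 + 2 |sin(πz/2)|²`. [folklore] -/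
private theorem cosh_le_one_add_two_mul_norm_sin_sq (z : ℂ) :
    Real.cosh (π * z.im) ≤ 1 + 2 * ‖Complex.sin (π * z / 2)‖ ^ 2 := by
  rw [norm_sin_sq, im_pi_mul_div_two]
  have key : Real.cosh (π * z.im) = 1 + 2 * Real.sinh (π * z.im / 2) ^ 2 := by
    have h := Real.cosh_two_mul (π * z.im / 2)
    rw [show 2 * (π * z.im / 2) = π * z.im by ring] at h
    rw [h, Real.cosh_sq]; ring
  rw [key]
  nlinarith [sq_nonneg (Real.sin ((π : ℂ) * z / 2).re)]

/-- `|sin x| = sin |x|` for `|x| ≤ π`. [folklore] -/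
private theorem abs_sin_eq_sin_abs {x : ℝ} (hx : |x| ≤ π) : |Real.sin x| = Real.sin |x| := by
  rcases le_or_gt 0 x with h | h
  · rw [abs_of_nonneg h, abs_of_nonneg (Real.sin_nonneg_of_nonneg_of_le_pi h (by rwa [abs_of_nonneg h] at hx))]
  · rw [abs_of_neg h]
    have : Real.sin (-x) ≥ 0 := Real.sin_nonneg_of_nonneg_of_le_pi (by linarith) (by rwa [abs_of_neg h] at hx)
    rw [Real.sin_neg] at this
    rw [abs_of_nonpos (by linarith), Real.sin_neg]

/-- Distance `δ` from `2ℤ` forces `|sin(πz/2)| ≥ δ/2`. [folklore] -/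
private theorem norm_sin_pi_div_two_ge {δ : ℝ} (hδ : 0 < δ) {z : ℂ} (h : ∀ j : ℤ, δ ≤ ‖z - 2 * j‖) :
    δ / 2 ≤ ‖Complex.sin (π * z / 2)‖ := by
  have hsq := norm_sin_sq (π * z / 2)
  rw [re_pi_mul_div_two, im_pi_mul_div_two] at hsq
  have hnn : 0 ≤ ‖Complex.sin (π * z / 2)‖ := norm_nonneg _
  by_cases ht : δ / 2 ≤ |z.im|
  · -- the imaginary part alone suffices
    have h1 : |z.im| ≤ |Real.sinh (π * z.im / 2)| := by
      rw [Real.abs_sinh]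
      have h2 : |π * z.im / 2| = π / 2 * |z.im| := by
        rw [abs_div, abs_mul, abs_of_pos Real.pi_pos, abs_of_pos (by norm_num : (0:ℝ) < 2)]; ring
      have h3 : |z.im| ≤ |π * z.im / 2| := by
        rw [h2]
        have := Real.two_le_pi
        nlinarith [abs_nonneg z.im]
      exact h3.trans (Real.self_le_sinh_iff.mpr (abs_nonneg _))
    have h4 : (δ / 2) ^ 2 ≤ ‖Complex.sin (π * z / 2)‖ ^ 2 := by
      rw [hsq]
      have h5 : (δ / 2) ^ 2 ≤ |Real.sinh (π * z.im / 2)| ^ 2 :=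
        pow_le_pow_left₀ (by linarith) (ht.trans h1) 2
      rw [sq_abs] at h5
      nlinarith [sq_nonneg (Real.sin (π * z.re / 2))]
    exact le_of_sq_le_sq h4 hnn  -- (δ/2)^2 ≤ s^2 → δ/2 ≤ s
  · push Not at ht
    set j : ℤ := round (z.re / 2) with hj
    have hround : |z.re / 2 - j| ≤ 1 / 2 := abs_sub_round _
    have hdist := h j
    -- ‖z - 2j‖² = (re - 2j)² + im²
    have hnormsq : ‖z - 2 * (j : ℂ)‖ ^ 2 = (z.re - 2 * j) ^ 2 + z.im ^ 2 := by
      rw [Complex.sq_norm, Complex.normSq_apply]; simp; ring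
    have hδsq : δ ^ 2 ≤ (z.re - 2 * j) ^ 2 + z.im ^ 2 := by
      rw [← hnormsq]; exact pow_le_pow_left₀ hδ.le hdist 2
    have him2 : z.im ^ 2 < (δ / 2) ^ 2 := by
      have := abs_nonneg z.im
      calc z.im ^ 2 = |z.im| ^ 2 := (sq_abs _).symm
        _ < (δ / 2) ^ 2 := pow_lt_pow_left₀ ht this two_ne_zero
    set w : ℝ := z.re / 2 - j with hw
    have hw2 : (δ / 4) ^ 2 < w ^ 2 := by
      have : (z.re - 2 * j) ^ 2 = 4 * w ^ 2 := by rw [hw]; ring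
      nlinarith
    have hwabs : δ / 4 < |w| := by
      have := sq_lt_sq.mp hw2
      rwa [abs_of_pos (by positivity : (0:ℝ) < δ / 4)] at this
    have hwle : |w| ≤ 1 / 2 := hround
    -- sin(π re/2) = ± sin(π w)
    have hsin : |Real.sin (π * z.re / 2)| = Real.sin (π * |w|) := by
      have e : π * z.re / 2 = π * w + j * π := by rw [hw]; ring
      rw [e, Real.sin_add_int_mul_pi, abs_mul, abs_zpow, abs_neg, abs_one, one_zpow, one_mul,
        abs_sin_eq_sin_abs, abs_mul, abs_of_pos Real.pi_pos]
      rw [abs_mul, abs_of_pos Real.pi_pos]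
      have := Real.pi_pos
      nlinarith
    have hjordan : 2 * |w| ≤ Real.sin (π * |w|) := by
      have h0 : 0 ≤ π * |w| := by positivity
      have h1 : π * |w| ≤ π / 2 := by
        have := Real.pi_pos; nlinarith
      have := Real.mul_le_sin h0 h1
      have hπ : π ≠ 0 := Real.pi_ne_zero
      calc 2 * |w| = 2 / π * (π * |w|) := by field_simp
        _ ≤ Real.sin (π * |w|) := this
    have h4 : (δ / 2) ^ 2 ≤ ‖Complex.sin (π * z / 2)‖ ^ 2 := by
      rw [hsq]
      have h6 : δ / 2 ≤ |Real.sin (π * z.re / 2)| := by rw [hsin]; linarith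
      have h7 : (δ / 2) ^ 2 ≤ |Real.sin (π * z.re / 2)| ^ 2 := pow_le_pow_left₀ (by linarith) h6 2
      rw [sq_abs] at h7
      nlinarith [sq_nonneg (Real.sinh (π * z.im / 2))]
    have := sq_le_sq.mp h4  -- hmm direction
    rw [abs_of_pos (by positivity : (0:ℝ) < δ / 2), abs_of_nonneg hnn] at this
    exact this

/-- `Γ(x) ≥ 1/2` for `x ≥ 1/2`. [folklore] -/
private theorem half_le_real_Gamma {x : ℝ} (hx : 1 / 2 ≤ x) : 1 / 2 ≤ Real.Gamma x := by
  have hmono : ∀ y : ℝ, 2 ≤ y → 1 ≤ Real.Gamma y := by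
    intro y hy
    have h := Real.Gamma_strictMonoOn_Ici.monotoneOn (Set.self_mem_Ici) (Set.mem_Ici.mpr hy) hy
    rwa [Real.Gamma_two] at h
  rcases le_or_gt 2 x with h2 | h2
  · linarith [hmono x h2]
  rcases le_or_gt 1 x with h1 | h1
  · -- 1 ≤ x < 2
    have hx0 : x ≠ 0 := by linarith
    have e := Real.Gamma_add_one hx0
    have hge := hmono (x + 1) (by linarith)
    rw [e] at hge
    have hxpos : 0 < x := by linarith
    nlinarith [Real.Gamma_pos_of_pos hxpos]
  · -- 1/2 ≤ x < 1
    have hx0 : x ≠ 0 := by linarith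
    have hx1 : x + 1 ≠ 0 := by linarith
    have e1 := Real.Gamma_add_one hx0
    have e2 := Real.Gamma_add_one hx1
    rw [show x + 1 + 1 = x + 2 by ring] at e2
    have hge := hmono (x + 2) (by linarith)
    rw [e2, e1] at hge
    have hxpos : 0 < x := by linarith
    have hG := Real.Gamma_pos_of_pos hxpos
    nlinarith [mul_pos hxpos hG]

/-- `(2π)^{x+n}/Γ(x+n) ≤ (2π)^x/Γ(x)` for `x ≥ 7`. [folklore] -/
private theorem two_pi_rpow_div_Gamma_add_nat_le (n : ℕ) {x : ℝ} (hx : 7 ≤ x) :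
    (2 * π) ^ (x + n) / Real.Gamma (x + n) ≤ (2 * π) ^ x / Real.Gamma x := by
  induction n with
  | zero => simp
  | succ n ih =>
    have hπ := Real.pi_lt_d2
    have hπ0 := Real.pi_pos
    have hxn : 0 < x + n := by positivity
    have hxn' : x + n ≠ 0 := hxn.ne'
    have e1 : (2 * π) ^ (x + (n + 1 : ℕ)) = (2 * π) ^ (x + n) * (2 * π) := by
      rw [show x + ((n + 1 : ℕ) : ℝ) = (x + n) + 1 by push_cast; ring, Real.rpow_add_one (by positivity)]
    have e2 : Real.Gamma (x + (n + 1 : ℕ)) = (x + n) * Real.Gamma (x + n) := by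
      rw [show x + ((n + 1 : ℕ) : ℝ) = (x + n) + 1 by push_cast; ring, Real.Gamma_add_one hxn']
    rw [e1, e2]
    have hG : 0 < Real.Gamma (x + n) := Real.Gamma_pos_of_pos hxn
    have hP : 0 < (2 * π) ^ (x + n) := by positivity
    calc (2 * π) ^ (x + ↑n) * (2 * π) / ((x + ↑n) * Real.Gamma (x + ↑n))
        = ((2 * π) / (x + n)) * ((2 * π) ^ (x + n) / Real.Gamma (x + n)) := by
          field_simp
      _ ≤ 1 * ((2 * π) ^ (x + n) / Real.Gamma (x + n)) := by
          gcongr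
          rw [div_le_one hxn]
          have : (n : ℝ) ≥ 0 := Nat.cast_nonneg n
          linarith
      _ ≤ (2 * π) ^ x / Real.Gamma x := by rw [one_mul]; exact ih

/-- `(2π)^x/Γ(x) ≤ 2(2π)^8` for `x ≥ 1/2`. [folklore] -/
private theorem two_pi_rpow_div_Gamma_le {x : ℝ} (hx : 1 / 2 ≤ x) :
    (2 * π) ^ x / Real.Gamma x ≤ 2 * (2 * π) ^ (8 : ℝ) := by
  have hπ0 := Real.pi_pos
  have hπ3 := Real.pi_gt_three
  have hbase : 1 ≤ 2 * π := by linarith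
  have key : ∀ y : ℝ, 1 / 2 ≤ y → y ≤ 8 → (2 * π) ^ y / Real.Gamma y ≤ 2 * (2 * π) ^ (8 : ℝ) := by
    intro y hy hy8
    have hG := half_le_real_Gamma hy
    have hGpos : 0 < Real.Gamma y := by linarith
    have hpow : (2 * π) ^ y ≤ (2 * π) ^ (8 : ℝ) := Real.rpow_le_rpow_of_exponent_le hbase hy8
    rw [div_le_iff₀ hGpos]
    have : 0 ≤ (2 * π) ^ (8 : ℝ) := by positivity
    nlinarith
  rcases le_or_gt x 8 with h8 | h8
  · exact key x hx h8
  · set n : ℕ := ⌊x - 7⌋₊ with hn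
    have hfl : (n : ℝ) ≤ x - 7 := Nat.floor_le (by linarith)
    have hfl' : x - 7 < n + 1 := Nat.lt_floor_add_one (x - 7)
    set x₀ : ℝ := x - n with hx₀
    have h7 : 7 ≤ x₀ := by rw [hx₀]; linarith
    have h8' : x₀ ≤ 8 := by rw [hx₀]; linarith
    have e : x = x₀ + n := by rw [hx₀]; ring
    rw [e]
    exact (two_pi_rpow_div_Gamma_add_nat_le n h7).trans (key x₀ (by linarith) h8')

/-- **`ρ_∞ = (2π)^{1−z} / (2 sin(πz/2) Γ(1−z))`** off the poles (reflection and duplication for `Γ`; for `Re z < 1`).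
[cite: ConnesConsani2021QuasiInner, §2 third display (arXiv chunk p0005:L19) with §2 Remark (p0006:L76)] -/
theorem rhoArch_eq_div_sin {z : ℂ} (hz1 : z.re < 1) (hz2 : ∀ n : ℕ, z ≠ -(2 * n)) :
    rhoArch z = (2 * π : ℂ) ^ (1 - z) / (2 * Complex.sin (π * z / 2) * Complex.Gamma (1 - z)) := by
  have h₂ : ∀ n : ℕ, z ≠ 2 * n + 1 := by
    intro n h; have := congrArg re h; simp at this; linarith
  have h3 : ∀ n : ℕ, (1 - z) ≠ -(2 * n + 1) := by
    intro n h; have := congrArg re h; simp at this; linarith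
  have hmul := rhoArch_one_sub_mul hz2 h₂
  have hcos := rhoArch_eq_two_mul_cos h3
  have hc : Complex.cos (π * (1 - z) / 2) = Complex.sin (π * z / 2) := by
    rw [show (π : ℂ) * (1 - z) / 2 = π / 2 - π * z / 2 by ring, Complex.cos_pi_div_two_sub]
  have hne : rhoArch (1 - z) ≠ 0 := by
    intro h; rw [h, zero_mul] at hmul; exact zero_ne_one hmul
  have hinv : rhoArch z = (rhoArch (1 - z))⁻¹ := by
    exact eq_inv_of_mul_eq_one_right hmul
  rw [hinv, hcos, hc, Complex.cpow_neg]
  have hb : (2 * π : ℂ) ^ (1 - z) ≠ 0 := by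
    rw [Ne, Complex.cpow_eq_zero_iff]; push Not
    intro h; exfalso
    have : (2 * π : ℂ) ≠ 0 := by exact_mod_cast (by positivity : (2 * π : ℝ) ≠ 0)
    exact this h
  field_simp

/-- `‖(2π)^{w}‖ = (2π)^{Re w}`. [folklore] -/
private theorem norm_two_pi_cpow (w : ℂ) : ‖(2 * π : ℂ) ^ w‖ = (2 * π) ^ w.re := by
  rw [show (2 * (π : ℂ)) = ((2 * π : ℝ) : ℂ) by push_cast; ring,
    Complex.norm_cpow_eq_rpow_re_of_pos (by positivity)]

/-- `Γ(1 − Re z) ≤ (1 + √2 |sin(πz/2)|) · |Γ(1 − z)|` for `Re z ≤ 1/2`. [folklore] -/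
private theorem real_Gamma_le_mul_norm_Gamma_one_sub {z : ℂ} (hz : z.re ≤ 1 / 2) :
    Real.Gamma (1 - z.re) ≤ (1 + Real.sqrt 2 * ‖Complex.sin (π * z / 2)‖) * ‖Complex.Gamma (1 - z)‖ := by
  have hx : 1 / 2 ≤ 1 - z.re := by linarith
  have h1 := real_Gamma_sq_le_cosh_mul_norm_sq hx (-z.im)
  have e : ((1 - z.re : ℝ) : ℂ) + ((-z.im : ℝ) : ℂ) * I = 1 - z := by
    apply Complex.ext <;> simp
  rw [e, show π * -z.im = -(π * z.im) by ring, Real.cosh_neg] at h1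
  have h2 := cosh_le_one_add_two_mul_norm_sin_sq z
  set s := ‖Complex.sin (π * z / 2)‖ with hs
  set G := ‖Complex.Gamma (1 - z)‖ with hG
  have hs0 : 0 ≤ s := norm_nonneg _
  have hG0 : 0 ≤ G := norm_nonneg _
  have h3 : Real.cosh (π * z.im) ≤ (1 + Real.sqrt 2 * s) ^ 2 := by
    have h22 : Real.sqrt 2 ^ 2 = 2 := Real.sq_sqrt (by norm_num)
    have hr2 : 0 ≤ Real.sqrt 2 := Real.sqrt_nonneg _
    nlinarith [mul_nonneg hr2 hs0]
  have h4 : Real.Gamma (1 - z.re) ^ 2 ≤ ((1 + Real.sqrt 2 * s) * G) ^ 2 := by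
    rw [mul_pow]
    exact h1.trans (mul_le_mul_of_nonneg_right h3 (sq_nonneg _))
  have h5 : 0 ≤ (1 + Real.sqrt 2 * s) * G := by positivity
  exact (abs_le_of_sq_le_sq' h4 h5).2

/-- **Uniform bound for `ρ_∞` in the closed left half-plane `Re z ≤ 1/2` away from its poles**: if
`|sin(πz/2)| ≥ c > 0` then `|ρ_∞(z)| ≤ (2π)^8 (c⁻¹ + √2)`. [cite: ConnesConsani2021QuasiInner, §2 estimates for ρ_∞ on the contour C_{R,m} (arXiv chunk p0005:L59–L83)] -/
theorem norm_rhoArch_le_of_norm_sin_ge {c : ℝ} (hc : 0 < c) {z : ℂ} (hz : z.re ≤ 1 / 2)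
    (hs : c ≤ ‖Complex.sin (π * z / 2)‖) :
    ‖rhoArch z‖ ≤ (2 * π) ^ (8 : ℝ) * (c⁻¹ + Real.sqrt 2) := by
  have hsin_ne : Complex.sin (π * z / 2) ≠ 0 := by
    intro h; rw [h, norm_zero] at hs; linarith
  have hz2 : ∀ n : ℕ, z ≠ -(2 * n) := by
    intro n h
    apply hsin_ne
    rw [h, show (π : ℂ) * -(2 * (n : ℂ)) / 2 = -((n : ℂ) * π) by ring, Complex.sin_neg,
      Complex.sin_nat_mul_pi, neg_zero]
  rw [rhoArch_eq_div_sin (by linarith) hz2, norm_div, norm_mul, norm_mul, norm_two_pi_cpow,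
    Complex.norm_ofNat]
  simp only [sub_re, one_re]
  set s := ‖Complex.sin (π * z / 2)‖ with hsdef
  set G := ‖Complex.Gamma (1 - z)‖ with hGdef
  set x := 1 - z.re with hxdef
  have hx : 1 / 2 ≤ x := by rw [hxdef]; linarith
  have hs0 : 0 < s := lt_of_lt_of_le hc hs
  have hΓ : 1 / 2 ≤ Real.Gamma x := half_le_real_Gamma hx
  have hΓ0 : 0 < Real.Gamma x := by linarith
  have hGge : Real.Gamma x ≤ (1 + Real.sqrt 2 * s) * G := real_Gamma_le_mul_norm_Gamma_one_sub hz
  have hr2 : 0 ≤ Real.sqrt 2 := Real.sqrt_nonneg _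
  have h1s : 0 < 1 + Real.sqrt 2 * s := by positivity
  have hG0 : 0 < G := by
    by_contra h
    push Not at h
    have : (1 + Real.sqrt 2 * s) * G ≤ 0 := mul_nonpos_of_nonneg_of_nonpos h1s.le h
    linarith
  have hP : 0 < (2 * π) ^ x := by positivity
  have hD := two_pi_rpow_div_Gamma_le hx
  have hD0 : 0 ≤ (2 * π) ^ (8 : ℝ) := by positivity
  -- 1/G ≤ (1 + √2 s)/Γ(x)
  have hinvG : G⁻¹ ≤ (1 + Real.sqrt 2 * s) / Real.Gamma x := by
    rw [inv_le_iff_one_le_mul₀ hG0, div_mul_eq_mul_div, one_le_div hΓ0]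
    exact hGge
  calc (2 * π) ^ x / (2 * s * G) = ((2 * π) ^ x / (2 * s)) * G⁻¹ := by
        field_simp
    _ ≤ ((2 * π) ^ x / (2 * s)) * ((1 + Real.sqrt 2 * s) / Real.Gamma x) := by
        gcongr
    _ = ((2 * π) ^ x / Real.Gamma x) * ((s⁻¹ + Real.sqrt 2) / 2) := by
        field_simp
    _ ≤ (2 * (2 * π) ^ (8 : ℝ)) * ((c⁻¹ + Real.sqrt 2) / 2) := by
        gcongr
    _ = (2 * π) ^ (8 : ℝ) * (c⁻¹ + Real.sqrt 2) := by ring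

/-- **`ρ_∞` is bounded on `{Re z ≤ 1/2}` at distance `≥ δ` from `2ℤ`.** [cite: ConnesConsani2021QuasiInner, §2 estimates for ρ_∞ on the contour C_{R,m} (arXiv chunk p0005:L59–L83)] -/
theorem exists_norm_rhoArch_le {δ : ℝ} (hδ : 0 < δ) :
    ∃ C : ℝ, 0 ≤ C ∧ ∀ z : ℂ, z.re ≤ 1 / 2 → (∀ j : ℤ, δ ≤ ‖z - 2 * j‖) → ‖rhoArch z‖ ≤ C := by
  refine ⟨(2 * π) ^ (8 : ℝ) * ((δ / 2)⁻¹ + Real.sqrt 2), by positivity, fun z hz hj => ?_⟩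
  exact norm_rhoArch_le_of_norm_sin_ge (half_pos hδ) hz (norm_sin_pi_div_two_ge hδ hj)


/-! ### B. The poles of `κ = ρ_∞ ∘ ψ` in the disc and their principal parts -/

/-- RH-FREE. The entire factor `E(z) = (2π)^{1−z}/(2Γ(1−z))` of `ρ_∞ = E / sin(πz/2)` is differentiable
everywhere (`1/Γ` is entire). [folklore] -/
private theorem differentiable_archEntire :
    Differentiable ℂ fun z : ℂ => (2 * π : ℂ) ^ (1 - z) / (2 * Complex.Gamma (1 - z)) := by
  have h2π : (2 * π : ℂ) ≠ 0 := by exact_mod_cast (by positivity : (2 * π : ℝ) ≠ 0)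
  have h1 : Differentiable ℂ fun z : ℂ => (2 * π : ℂ) ^ (1 - z) :=
    fun z => ((differentiableAt_const _).sub differentiableAt_id).const_cpow (Or.inl h2π)
  have h2 : Differentiable ℂ fun z : ℂ => (Complex.Gamma (1 - z))⁻¹ :=
    Complex.differentiable_one_div_Gamma.comp ((differentiable_const _).sub differentiable_id)
  have e : (fun z : ℂ => (2 * π : ℂ) ^ (1 - z) / (2 * Complex.Gamma (1 - z))) =
      fun z => (2 * π : ℂ) ^ (1 - z) * ((2 : ℂ)⁻¹ * (Complex.Gamma (1 - z))⁻¹) := by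
    funext z; rw [div_eq_mul_inv, mul_inv]
  rw [e]
  exact h1.mul ((differentiable_const _).mul h2)

/-- RH-FREE. `sin(x − nπ) = (−1)^n sin x` on `ℂ`. [folklore] -/
private theorem sin_sub_nat_mul_pi_complex (x : ℂ) (n : ℕ) :
    Complex.sin (x - n * π) = (-1) ^ n * Complex.sin x := by
  induction n with
  | zero => simp
  | succ n ih =>
    rw [show x - ((n + 1 : ℕ) : ℂ) * π = (x - n * π) - π by push_cast; ring, Complex.sin_sub_pi, ih,
      pow_succ]
    ring

/-- RH-FREE. The function `1/sin w − 1/w` has a (finite) limit at `w = 0` (removable singularity;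
`sin w = w·S(w)` with `S = dslope sin 0` analytic, `S(0) = 1`). [folklore] -/
private theorem exists_tendsto_inv_sin_sub_inv :
    ∃ R₀ : ℂ, Tendsto (fun w : ℂ => (Complex.sin w)⁻¹ - w⁻¹) (𝓝[≠] 0) (𝓝 R₀) := by
  set S := dslope Complex.sin 0 with hS
  have hsin_an : AnalyticAt ℂ Complex.sin 0 :=
    Complex.differentiable_sin.differentiableOn.analyticAt Filter.univ_mem
  have hS_an : AnalyticAt ℂ S 0 := by
    obtain ⟨p, hp⟩ := hsin_an
    exact ⟨_, hp.has_fpower_series_dslope_fslope⟩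
  have hS0 : S 0 = 1 := by
    rw [hS, dslope_same, (Complex.hasDerivAt_sin 0).deriv, Complex.cos_zero]
  have hSd : HasDerivAt S (deriv S 0) 0 := hS_an.differentiableAt.hasDerivAt
  have hslope : Tendsto (slope S 0) (𝓝[≠] 0) (𝓝 (deriv S 0)) := hasDerivAt_iff_tendsto_slope.mp hSd
  have hScont : Tendsto S (𝓝[≠] 0) (𝓝 1) :=
    hS0 ▸ (hS_an.continuousAt.tendsto.mono_left nhdsWithin_le_nhds)
  have hSne : ∀ᶠ w in 𝓝[≠] (0 : ℂ), S w ≠ 0 :=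
    hScont.eventually_ne one_ne_zero
  refine ⟨-(deriv S 0) / 1, ?_⟩
  have hlim := (hslope.neg).div hScont one_ne_zero
  refine hlim.congr' ?_
  filter_upwards [hSne, self_mem_nhdsWithin] with w hw hw0
  have hw0' : w ≠ 0 := hw0
  have e1 : Complex.sin w = w * S w := by
    have h := sub_smul_dslope Complex.sin 0 w
    rw [sub_zero, Complex.sin_zero, sub_zero, smul_eq_mul] at h
    rw [← hS] at h
    exact h.symm
  show (-slope S 0 w) / S w = _
  rw [slope_def_field, hS0, sub_zero, e1]
  field_simp
  ring

/-- RH-FREE. The residue datum of `ρ_∞` at `z = −2n`: `Res_n = (−1)^n · 2·(2π)^{2n}/(2n)!`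
(print: `(−1)^n 2π^{2n+½}/(Γ(n+1)Γ(n+½))`, the same number by Legendre's duplication formula);
`ρ_∞(z) − Res_n/(z + 2n)` has a finite limit at `z = −2n` (simple pole).
[cite: ConnesConsani2021QuasiInner, §2 displays after «Then we apply Cauchy's residue theorem» (arXiv chunk p0005:L93–L104)] -/
theorem exists_tendsto_rhoArch_sub_pole (n : ℕ) :
    ∃ L : ℂ, Tendsto
      (fun z : ℂ => rhoArch z - ((-1) ^ n * 2 * (2 * π) ^ (2 * n) / (2 * n).factorial : ℂ) / (z + 2 * n))
      (𝓝[≠] (-(2 * n))) (𝓝 L) := by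
  set z₀ : ℂ := -(2 * n) with hz₀
  set E : ℂ → ℂ := fun z => (2 * π : ℂ) ^ (1 - z) / (2 * Complex.Gamma (1 - z)) with hE
  set Res : ℂ := (-1) ^ n * 2 * (2 * π) ^ (2 * n) / (2 * n).factorial with hRes
  obtain ⟨R₀, hR⟩ := exists_tendsto_inv_sin_sub_inv
  have hπ : (π : ℂ) ≠ 0 := ofReal_ne_zero.mpr Real.pi_ne_zero
  -- value of E at the pole
  have hEz₀ : E z₀ = (2 * π : ℂ) ^ (2 * n + 1) / (2 * (2 * n).factorial) := by
    simp only [hE, hz₀]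
    rw [show (1 : ℂ) - -(2 * (n : ℂ)) = ((2 * n + 1 : ℕ) : ℂ) by push_cast; ring, Complex.cpow_natCast,
      show ((2 * n + 1 : ℕ) : ℂ) = ((2 * n : ℕ) : ℂ) + 1 by push_cast; ring, Complex.Gamma_nat_eq_factorial]
  have hResE : Res = (-1) ^ n * (2 / π) * E z₀ := by
    rw [hRes, hEz₀]
    field_simp
    ring
  -- the linear change of variable w = π (z − z₀)/2
  set wf : ℂ → ℂ := fun z => π * (z - z₀) / 2 with hwf
  have hwf_tend : Tendsto wf (𝓝[≠] z₀) (𝓝[≠] 0) := by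
    refine tendsto_nhdsWithin_of_tendsto_nhds_of_eventually_within _ ?_ ?_
    · have : Continuous wf := by simp only [hwf]; fun_prop
      have h0 : wf z₀ = 0 := by simp [hwf]
      exact h0 ▸ (this.tendsto z₀).mono_left nhdsWithin_le_nhds
    · filter_upwards [self_mem_nhdsWithin] with z hz
      simp only [hwf, mem_compl_iff, mem_singleton_iff]
      intro h
      apply hz
      have : z - z₀ = 0 := by
        have h2 : (π : ℂ) * (z - z₀) = 0 := by
          have := congrArg (· * (2:ℂ)) h; simpa using this
        exact (mul_eq_zero.mp h2).resolve_left hπ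
      exact sub_eq_zero.mp this
  have hEd : Differentiable ℂ E := differentiable_archEntire
  have hEslope : Tendsto (slope E z₀) (𝓝[≠] z₀) (𝓝 (deriv E z₀)) :=
    hasDerivAt_iff_tendsto_slope.mp (hEd z₀).hasDerivAt
  have hEcont : Tendsto E (𝓝[≠] z₀) (𝓝 (E z₀)) :=
    ((hEd z₀).continuousAt.tendsto).mono_left nhdsWithin_le_nhds
  refine ⟨(-1) ^ n * (E z₀ * R₀ + (2 / π) * deriv E z₀), ?_⟩
  have hlim : Tendsto (fun z => (-1 : ℂ) ^ n * (E z * ((Complex.sin (wf z))⁻¹ - (wf z)⁻¹) +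
      (2 / π) * slope E z₀ z)) (𝓝[≠] z₀) (𝓝 ((-1) ^ n * (E z₀ * R₀ + (2 / π) * deriv E z₀))) :=
    ((hEcont.mul (hR.comp hwf_tend)).add (hEslope.const_mul _)).const_mul _
  refine hlim.congr' ?_
  -- the identity on a punctured neighbourhood of z₀
  have hball : ∀ᶠ z in 𝓝[≠] z₀, ‖z - z₀‖ < 1 := by
    have : Metric.ball z₀ 1 ∈ 𝓝 z₀ := Metric.ball_mem_nhds _ one_pos
    filter_upwards [mem_nhdsWithin_of_mem_nhds this] with z hz
    simpa [Metric.mem_ball, dist_eq_norm] using hz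
  filter_upwards [hball, self_mem_nhdsWithin] with z hz hzne
  have hzne' : z ≠ z₀ := hzne
  have hre : z.re < 1 := by
    have h1 : |(z - z₀).re| < 1 := (abs_re_le_norm _).trans_lt hz
    rw [sub_re] at h1
    have : z₀.re = -(2 * n) := by simp [hz₀]
    rw [this] at h1
    have hn : (0:ℝ) ≤ n := Nat.cast_nonneg n
    have := (abs_lt.mp h1).2
    linarith
  have hpoles : ∀ k : ℕ, z ≠ -(2 * k) := by
    intro k hk
    rcases eq_or_ne k n with rfl | hkn
    · exact hzne' (by rw [hk, hz₀])
    · -- distinct poles are at distance ≥ 2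
      have h2 : (2:ℝ) ≤ ‖z - z₀‖ := by
        rw [hk, hz₀, show (-(2 * (k : ℂ)) - -(2 * (n : ℂ))) = ((2 * ((n : ℤ) - k) : ℤ) : ℂ) by push_cast; ring,
          Complex.norm_intCast]
        have : (1 : ℤ) ≤ |(n : ℤ) - k| := by
          apply Int.one_le_abs
          omega
        have h3 : |((2 * ((n : ℤ) - k) : ℤ) : ℝ)| = 2 * |(((n : ℤ) - k : ℤ) : ℝ)| := by
          push_cast; rw [abs_mul, abs_two]
        rw [h3]
        have h4 : (1:ℝ) ≤ |(((n : ℤ) - k : ℤ) : ℝ)| := by exact_mod_cast this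
        linarith
      linarith
  have hρ := rhoArch_eq_div_sin hre hpoles
  -- sin(π z/2) = (−1)^n sin(w)
  have hsin : Complex.sin (π * z / 2) = (-1) ^ n * Complex.sin (wf z) := by
    have e : (π : ℂ) * z / 2 = wf z - n * π := by simp only [hwf, hz₀]; ring
    rw [e, sin_sub_nat_mul_pi_complex]
  have hw0 : wf z ≠ 0 := by
    simp only [hwf]
    intro h
    apply hzne'
    have h2 : (π : ℂ) * (z - z₀) = 0 := by
      have := congrArg (· * (2:ℂ)) h; simpa using this
    exact sub_eq_zero.mp ((mul_eq_zero.mp h2).resolve_left hπ)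
  have hsw : Complex.sin (wf z) ≠ 0 := by
    intro h
    obtain ⟨j, hj⟩ := Complex.sin_eq_zero_iff.mp h
    have hnorm : ‖wf z‖ < π / 2 * 1 := by
      simp only [hwf]
      rw [norm_div, norm_mul, Complex.norm_real, Real.norm_eq_abs, abs_of_pos Real.pi_pos,
        Complex.norm_ofNat]
      have := Real.pi_pos
      calc π * ‖z - z₀‖ / 2 = π / 2 * ‖z - z₀‖ := by ring
        _ < π / 2 * 1 := by gcongr
    rw [hj, norm_mul, Complex.norm_real, Real.norm_eq_abs, abs_of_pos Real.pi_pos,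
      Complex.norm_intCast] at hnorm
    have hj0 : j ≠ 0 := by
      rintro rfl; simp at hj; exact hw0 hj
    have : (1:ℝ) ≤ |(j:ℝ)| := by exact_mod_cast Int.one_le_abs hj0
    nlinarith [Real.pi_pos]
  have hm1 : ((-1 : ℂ) ^ n) ≠ 0 := pow_ne_zero _ (by norm_num)
  have hρ' : rhoArch z = E z / Complex.sin (π * z / 2) := by
    rw [hρ]; simp only [hE]; field_simp
  have hzz : z + 2 * n = 2 * wf z / π := by simp only [hwf, hz₀]; field_simp; ring
  have hzz' : z - z₀ = 2 * wf z / π := by simp only [hwf]; field_simp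
  rw [hρ', hzz, hResE, slope_def_field, hsin, hzz']
  generalize hA : E z = A
  generalize hB : E z₀ = B
  rcases neg_one_pow_eq_or ℂ n with h1 | h1 <;>
  · rw [h1]
    field_simp
    ring


/-! #### Transport to the disc: the poles `x_n = ψ⁻¹(−2n)` of `κ` and their residues `α(n)` -/

/-- RH-FREE. `ψ(v) − ψ(x) = −2(v − x)/((v − 1)(x − 1))` (`ψ` is a Möbius map; print: «the conformal transformation ψ …
from the unit disk to the half plane ℂ₋»). [cite: ConnesConsani2021QuasiInner, Introduction (arXiv chunk p0003:L26)] -/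
theorem cayley_sub_cayley {v x : ℂ} (hv : v ≠ 1) (hx : x ≠ 1) :
    cayley v - cayley x = -2 * (v - x) / ((v - 1) * (x - 1)) := by
  have hv' : v - 1 ≠ 0 := sub_ne_zero.mpr hv
  have hx' : x - 1 ≠ 0 := sub_ne_zero.mpr hx
  simp only [cayley]
  field_simp
  ring

/-- RH-FREE. `x(n) ≠ 1`. [cite: ConnesConsani2021QuasiInner, §2 (arXiv chunk p0005:L122)] -/
theorem xArch_ne_one (n : ℕ) : (xArch n : ℂ) ≠ 1 := by
  intro h
  have h' : xArch n = 1 := by exact_mod_cast h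
  have := xArch_lt_one n
  rw [h', abs_one] at this
  exact lt_irrefl _ this

/-- RH-FREE. `x(n) − 1 = −4/(4n+3)` (as complex numbers). [cite: ConnesConsani2021QuasiInner, §2 (p0005:L115)] -/
theorem xArch_sub_one (n : ℕ) : (xArch n : ℂ) - 1 = -4 / (4 * n + 3) := by
  have h : (4 * (n : ℂ) + 3) ≠ 0 := by
    intro h; have := congrArg re h; simp at this; linarith [n.cast_nonneg (α := ℝ)]
  simp only [xArch]
  push_cast
  field_simp
  ring

/-- RH-FREE. `ψ(x(n)) = −2n`. [cite: ConnesConsani2021QuasiInner, §2 (arXiv chunk p0005:L94–L115)] -/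
theorem cayley_xArch (n : ℕ) : cayley (xArch n : ℂ) = -(2 * n) := by
  rw [xArch_eq_cayleyInv, cayley_cayleyInv]
  intro h
  have := congrArg re h
  simp at this
  linarith [n.cast_nonneg (α := ℝ)]

/-- RH-FREE. Partial fractions of the transported pole: for `v ≠ 1`, `v ≠ x(n)`,
`1/(ψ(v) + 2n) = (−8/(4n+3)²)/(v − x(n)) + 2/(4n+3)` (the factor `−8/(2z−3)² = dψ⁻¹/dz` of print at `z = −2n`).
[cite: ConnesConsani2021QuasiInner, §2 «implementing the differential dψ⁻¹(z) = −8/(2z−3)² dz» (arXiv chunk p0005:L38–L44)] -/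
theorem inv_cayley_add_two_mul (n : ℕ) {v : ℂ} (hv : v ≠ 1) (hvx : v ≠ xArch n) :
    (cayley v + 2 * n)⁻¹ = (-8 / (4 * (n : ℂ) + 3) ^ 2) / (v - xArch n) + 2 / (4 * n + 3) := by
  have h43 : (4 * (n : ℂ) + 3) ≠ 0 := by
    intro h; have := congrArg re h; simp at this; linarith [n.cast_nonneg (α := ℝ)]
  have hvx' : v - xArch n ≠ 0 := sub_ne_zero.mpr hvx
  have hv' : v - 1 ≠ 0 := sub_ne_zero.mpr hv
  have e : cayley v + 2 * n = cayley v - cayley (xArch n) := by rw [cayley_xArch]; ring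
  rw [e, cayley_sub_cayley hv (xArch_ne_one n), xArch_sub_one]
  have e2 : ((xArch n : ℂ)) = 1 - 4 / (4 * n + 3) := by
    have := xArch_sub_one n; linear_combination this
  -- `(ψ(v) + 2n) · RHS = 1`
  symm
  apply eq_inv_of_mul_eq_one_left
  rw [div_add_div _ _ hvx' h43, div_mul_div_comm, div_eq_one_iff_eq (by
    apply mul_ne_zero (mul_ne_zero hvx' h43)
    apply mul_ne_zero hv'
    exact div_ne_zero (by norm_num) h43)]
  rw [e2] at hvx' ⊢
  field_simp
  ring

open scoped Nat in
/-- RH-FREE. The residue coefficients in closed form: `α(n) = (−1)^{n+1} 16 (2π)^{2n}/((2n)! (4n+3)²)`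
(print: `(−1)^{n+1}16π^{2n+½}(4n+3)^{−2}/(Γ(n+1)Γ(n+½))`; Legendre duplication `Γ(n+1)Γ(n+½) = (2n)!√π/4^n`).
[cite: ConnesConsani2021QuasiInner, §2 display «aminusk» (arXiv chunk p0005:L115)] -/
theorem alphaArch_eq (n : ℕ) :
    alphaArch n = (-1) ^ (n + 1) * 16 * (2 * π) ^ (2 * n) / ((2 * n)! * (4 * (n : ℝ) + 3) ^ 2) := by
  have hdup := Real.Gamma_mul_Gamma_add_half ((n : ℝ) + 1 / 2)
  have e1 : (n : ℝ) + 1 / 2 + 1 / 2 = n + 1 := by ring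
  have e2 : 2 * ((n : ℝ) + 1 / 2) = ((2 * n : ℕ) : ℝ) + 1 := by push_cast; ring
  have e3 : (1 : ℝ) - (((2 * n : ℕ) : ℝ) + 1) = -((2 * n : ℕ) : ℝ) := by ring
  rw [e1, e2, e3, Real.Gamma_nat_eq_factorial (2 * n), Real.rpow_neg (by norm_num), Real.rpow_natCast]
    at hdup
  -- hdup : Γ(n+1/2) Γ(n+1) = (2n)! * (2^(2n))⁻¹ * √π
  have hG1 : Real.Gamma ((n : ℝ) + 1) = n ! := Real.Gamma_nat_eq_factorial n
  have hsqrt : Real.sqrt π ≠ 0 := (Real.sqrt_pos.mpr Real.pi_pos).ne'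
  have hfac : ((2 * n)! : ℝ) ≠ 0 := by positivity
  have h43 : (4 * (n : ℝ) + 3) ≠ 0 := by positivity
  have hprod : Real.Gamma ((n : ℝ) + 1) * Real.Gamma ((n : ℝ) + 1 / 2) =
      (2 * n)! * ((2:ℝ) ^ (2 * n))⁻¹ * Real.sqrt π := by rw [mul_comm, hdup]
  unfold alphaArch
  rw [hprod]
  have h22 : (2:ℝ) ^ (2 * n) ≠ 0 := by positivity
  field_simp
  rw [show (2 * π) ^ (2 * n) = (2:ℝ) ^ (2 * n) * π ^ (2 * n) by rw [mul_pow]]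
  ring

open scoped Nat in
/-- RH-FREE. `α(n) = Res_n · (−8/(4n+3)²)` with `Res_n = (−1)^n 2(2π)^{2n}/(2n)!` the residue of `ρ_∞` at `−2n` and
`−8/(4n+3)² = 1/ψ′(x(n))`. [cite: ConnesConsani2021QuasiInner, §2 residue formula (arXiv chunk p0005:L106–L115)] -/
theorem alphaArch_eq_res_mul (n : ℕ) :
    (alphaArch n : ℂ) = ((-1) ^ n * 2 * (2 * π) ^ (2 * n) / (2 * n)! : ℂ) * (-8 / (4 * (n : ℂ) + 3) ^ 2) := by
  rw [alphaArch_eq]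
  have hfac : ((2 * n)! : ℂ) ≠ 0 := by exact_mod_cast (Nat.factorial_ne_zero _)
  have h43 : (4 * (n : ℂ) + 3) ≠ 0 := by
    intro h; have := congrArg re h; simp at this; linarith [n.cast_nonneg (α := ℝ)]
  push_cast
  field_simp
  ring

/-- RH-FREE. `ψ` is differentiable off `v = 1` («the conformal transformation ψ»). [cite: ConnesConsani2021QuasiInner, Introduction (arXiv chunk p0003:L26)] -/
theorem differentiableAt_cayley {v : ℂ} (hv : v ≠ 1) : DifferentiableAt ℂ cayley v := by
  unfold cayley
  exact (differentiableAt_const _).add ((differentiableAt_id.add (differentiableAt_const _)).div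
    (differentiableAt_id.sub (differentiableAt_const _)) (sub_ne_zero.mpr hv))

/-- RH-FREE. In the open unit disc the poles of `κ` are exactly the `x(n)`: if `|v| < 1` and `v ∉ {x(n)}` then
`Γ_ℝ(ψ(v)) ≠ 0`. [cite: ConnesConsani2021QuasiInner, §2 (arXiv chunk p0005:L94)] -/
theorem Gammaℝ_cayley_ne_zero {v : ℂ} (hv : v ≠ 1) (hx : ∀ n : ℕ, v ≠ xArch n) :
    Gammaℝ (cayley v) ≠ 0 := by
  intro h
  obtain ⟨n, hn⟩ := Gammaℝ_eq_zero_iff.mp h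
  apply hx n
  have := congrArg cayleyInv hn
  rwa [cayleyInv_cayley hv, ← xArch_eq_cayleyInv] at this

/-- RH-FREE. `κ = ρ_∞ ∘ ψ` is differentiable at every non-pole point `v ≠ 1` of the plane.
[cite: ConnesConsani2021QuasiInner, §2 display defining κ (arXiv chunk p0005:L25–L29)] -/
theorem differentiableAt_kappaArch {v : ℂ} (hv : v ≠ 1) (hx : ∀ n : ℕ, v ≠ xArch n) :
    DifferentiableAt ℂ kappaArch v :=
  (differentiableAt_rhoArch (Gammaℝ_cayley_ne_zero hv hx)).comp v (differentiableAt_cayley hv)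

open scoped Nat in
/-- RH-FREE. **`κ` has a simple pole at `x(n)` with residue `α(n)`**: `κ(v) − α(n)/(v − x(n))` has a finite
limit as `v → x(n)`. [cite: ConnesConsani2021QuasiInner, §2 residue computation (arXiv chunk p0005:L93–L115)] -/
theorem exists_tendsto_kappaArch_sub_pole (n : ℕ) :
    ∃ L : ℂ, Tendsto (fun v : ℂ => kappaArch v - (alphaArch n : ℂ) / (v - xArch n))
      (𝓝[≠] (xArch n : ℂ)) (𝓝 L) := by
  obtain ⟨L, hL⟩ := exists_tendsto_rhoArch_sub_pole n
  set Res : ℂ := (-1) ^ n * 2 * (2 * π) ^ (2 * n) / (2 * n)! with hRes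
  have h1 : ∀ᶠ v in 𝓝[≠] (xArch n : ℂ), v ≠ 1 :=
    mem_nhdsWithin_of_mem_nhds (isOpen_ne.mem_nhds (xArch_ne_one n))
  have hψ : Tendsto cayley (𝓝[≠] (xArch n : ℂ)) (𝓝[≠] (-(2 * n))) := by
    refine tendsto_nhdsWithin_of_tendsto_nhds_of_eventually_within _ ?_ ?_
    · have hc := (differentiableAt_cayley (xArch_ne_one n)).continuousAt.tendsto
      rw [cayley_xArch] at hc
      exact hc.mono_left nhdsWithin_le_nhds
    · filter_upwards [h1, self_mem_nhdsWithin] with v hv1 hvx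
      have hvx' : v ≠ xArch n := hvx
      intro h
      have h' : cayley v - cayley (xArch n) = 0 := by
        rw [cayley_xArch]; simp only [mem_singleton_iff] at h; rw [h]; ring
      rw [cayley_sub_cayley hv1 (xArch_ne_one n)] at h'
      rcases div_eq_zero_iff.mp h' with h'' | h''
      · apply hvx'
        have : v - xArch n = 0 := by
          rcases mul_eq_zero.mp h'' with h3 | h3
          · norm_num at h3
          · exact h3
        exact sub_eq_zero.mp this
      · rcases mul_eq_zero.mp h'' with h3 | h3
        · exact hv1 (sub_eq_zero.mp h3)
        · exact xArch_ne_one n (sub_eq_zero.mp h3)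
  refine ⟨L + Res * (2 / (4 * n + 3)), ?_⟩
  have hlim := (hL.comp hψ).add (tendsto_const_nhds (x := Res * (2 / (4 * (n : ℂ) + 3))))
  refine hlim.congr' ?_
  filter_upwards [h1, self_mem_nhdsWithin] with v hv1 hvx
  have hvx' : v ≠ xArch n := hvx
  simp only [Function.comp_apply, kappaArch]
  rw [alphaArch_eq_res_mul, ← hRes, mul_div_assoc,
    show (-8 / (4 * (n : ℂ) + 3) ^ 2) / (v - xArch n) = (cayley v + 2 * n)⁻¹ - 2 / (4 * n + 3) by
      rw [inv_cayley_add_two_mul n hv1 hvx']; ring]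
  rw [div_eq_mul_inv Res]
  ring

/-! ### C. Geometry of `ψ` on the circles `|v| = r_m`, `r_m = (4m+1)/(4m+5) = ψ⁻¹(−2m−1)` -/

/-- RH-FREE. `Re ψ(v) ≤ ½` on the closed unit disc (`ψ` maps the disc to `ℂ₋`).
[cite: ConnesConsani2021QuasiInner, Introduction (arXiv chunk p0003:L26)] -/
theorem re_cayley_le {v : ℂ} (hv : ‖v‖ ≤ 1) : (cayley v).re ≤ 1 / 2 := by
  by_cases h1 : v = 1
  · subst h1; norm_num [cayley]
  have hne : v - 1 ≠ 0 := sub_ne_zero.mpr h1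
  have hns : 0 < Complex.normSq (v - 1) := Complex.normSq_pos.mpr hne
  have hab : v.re * v.re + v.im * v.im ≤ 1 := by
    rw [← Complex.normSq_apply, Complex.normSq_eq_norm_sq]; nlinarith [norm_nonneg v]
  rw [cayley, add_re, Complex.div_re (v + 1) (v - 1), ← add_div]
  simp only [add_re, one_re, sub_re, add_im, one_im, sub_im, add_zero, sub_zero]
  have h12 : ((1 : ℂ) / 2).re = 1 / 2 := by norm_num
  rw [h12]
  have : ((v.re + 1) * (v.re - 1) + v.im * v.im) / Complex.normSq (v - 1) ≤ 0 :=
    div_nonpos_of_nonpos_of_nonneg (by nlinarith) hns.le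
  linarith

/-- RH-FREE. For `|v| = r` and real `x`: `‖v − x‖² = r² + x² − 2x·Re v`, `‖v − 1‖² = r² + 1 − 2·Re v`. [folklore] -/
private theorem norm_sub_real_sq {v : ℂ} {r : ℝ} (hv : ‖v‖ = r) (x : ℝ) :
    ‖v - x‖ ^ 2 = r ^ 2 + x ^ 2 - 2 * x * v.re := by
  have h : v.re * v.re + v.im * v.im = r ^ 2 := by
    rw [← Complex.normSq_apply, Complex.normSq_eq_norm_sq, hv]
  rw [Complex.sq_norm, Complex.normSq_apply]
  simp only [sub_re, ofReal_re, sub_im, ofReal_im, sub_zero]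
  nlinarith

/-- RH-FREE. The elementary extremal fact behind the contour estimate: for `0 < r < 1`, `|s| ≤ r`,
`min(((r−x)/(1−r))², ((r+x)/(1+r))²) ≤ (r² + x² − 2xs)/(r² + 1 − 2s)` (the quotient is monotone in `s`).
[folklore] -/
private theorem min_sq_le_quot {r x s : ℝ} (hr0 : 0 < r) (hr1 : r < 1) (hs : |s| ≤ r) :
    min (((r - x) / (1 - r)) ^ 2) (((r + x) / (1 + r)) ^ 2) ≤
      (r ^ 2 + x ^ 2 - 2 * x * s) / (r ^ 2 + 1 - 2 * s) := by
  have hs' := abs_le.mp hs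
  have hD : 0 < r ^ 2 + 1 - 2 * s := by nlinarith
  have h1r : 0 < 1 - r := by linarith
  have h1r' : 0 < 1 + r := by linarith
  have eP : (r ^ 2 + x ^ 2 - 2 * x * s) / (r ^ 2 + 1 - 2 * s) - ((r + x) / (1 + r)) ^ 2 =
      2 * ((1 - x) * (r ^ 2 - x)) * (r + s) / ((r ^ 2 + 1 - 2 * s) * (1 + r) ^ 2) := by
    field_simp
    ring
  have eM : (r ^ 2 + x ^ 2 - 2 * x * s) / (r ^ 2 + 1 - 2 * s) - ((r - x) / (1 - r)) ^ 2 =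
      -(2 * ((1 - x) * (r ^ 2 - x)) * (r - s)) / ((r ^ 2 + 1 - 2 * s) * (1 - r) ^ 2) := by
    field_simp
    ring
  rcases le_or_gt 0 ((1 - x) * (r ^ 2 - x)) with hsgn | hsgn
  · apply min_le_of_right_le
    have : 0 ≤ 2 * ((1 - x) * (r ^ 2 - x)) * (r + s) / ((r ^ 2 + 1 - 2 * s) * (1 + r) ^ 2) := by
      apply div_nonneg _ (by positivity); nlinarith
    linarith
  · apply min_le_of_left_le
    have : 0 ≤ -(2 * ((1 - x) * (r ^ 2 - x)) * (r - s)) / ((r ^ 2 + 1 - 2 * s) * (1 - r) ^ 2) := by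
      apply div_nonneg _ (by positivity); nlinarith
    linarith

/-- RH-FREE. Lower bound for `‖v − x‖/‖v − 1‖` on the circle `|v| = r` (`0 < r < 1`, `x` real): any common
lower bound `L ≥ 0` of `|r − x|/(1 − r)` and `|r + x|/(1 + r)` works. [folklore] -/
private theorem le_norm_sub_div_norm_sub_one {v : ℂ} {r x L : ℝ} (hr0 : 0 < r) (hr1 : r < 1) (hv : ‖v‖ = r)
    (hL : 0 ≤ L) (h₁ : L ≤ |r - x| / (1 - r)) (h₂ : L ≤ |r + x| / (1 + r)) :
    L ≤ ‖v - x‖ / ‖v - 1‖ := by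
  have hs : |v.re| ≤ r := hv ▸ Complex.abs_re_le_norm v
  have h1 : ‖v - 1‖ ^ 2 = r ^ 2 + 1 ^ 2 - 2 * 1 * v.re := by
    have := norm_sub_real_sq hv 1; simpa using this
  have hx : ‖v - x‖ ^ 2 = r ^ 2 + x ^ 2 - 2 * x * v.re := norm_sub_real_sq hv x
  have hD : 0 < r ^ 2 + 1 - 2 * v.re := by nlinarith [(abs_le.mp hs).2]
  have hne : v ≠ 1 := by
    intro h; rw [h, norm_one] at hv; linarith
  have hv1 : 0 < ‖v - 1‖ := norm_pos_iff.mpr (sub_ne_zero.mpr hne)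
  have hmin := min_sq_le_quot (x := x) hr0 hr1 hs
  have hL1 : L ^ 2 ≤ ((r - x) / (1 - r)) ^ 2 := by
    have := pow_le_pow_left₀ hL h₁ 2
    rwa [div_pow, sq_abs, ← div_pow] at this
  have hL2 : L ^ 2 ≤ ((r + x) / (1 + r)) ^ 2 := by
    have := pow_le_pow_left₀ hL h₂ 2
    rwa [div_pow, sq_abs, ← div_pow] at this
  have hL3 : L ^ 2 ≤ min (((r - x) / (1 - r)) ^ 2) (((r + x) / (1 + r)) ^ 2) := le_min hL1 hL2
  have hquot : (r ^ 2 + x ^ 2 - 2 * x * v.re) / (r ^ 2 + 1 - 2 * v.re) = (‖v - ↑x‖ / ‖v - 1‖) ^ 2 := by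
    rw [div_pow, hx, h1]; ring
  have h4 : L ^ 2 ≤ (‖v - ↑x‖ / ‖v - 1‖) ^ 2 := by
    rw [← hquot]; exact hL3.trans hmin
  exact (abs_le_of_sq_le_sq' h4 (by positivity)).2

/-- RH-FREE. `|ψ(v) + 2n| = (4n+3)‖v − x(n)‖/(2‖v − 1‖)` for `v ≠ 1` (distance of `ψ(v)` to the pole `−2n = ψ(x(n))`).
[cite: ConnesConsani2021QuasiInner, §2 poles −2n of the integrand (arXiv chunk p0005:L94)] -/
theorem norm_cayley_add_two_mul (n : ℕ) {v : ℂ} (hv : v ≠ 1) :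
    ‖cayley v + 2 * n‖ = (4 * n + 3) * ‖v - xArch n‖ / (2 * ‖v - 1‖) := by
  have e : cayley v + 2 * n = cayley v - cayley (xArch n) := by rw [cayley_xArch]; ring
  rw [e, cayley_sub_cayley hv (xArch_ne_one n), xArch_sub_one, norm_div, norm_mul, norm_mul, norm_neg,
    Complex.norm_ofNat, norm_div, norm_neg]
  have h43 : ‖(4 * (n : ℂ) + 3)‖ = 4 * n + 3 := by
    rw [show (4 * (n : ℂ) + 3) = ((4 * (n : ℝ) + 3 : ℝ) : ℂ) by push_cast; ring, Complex.norm_real,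
      Real.norm_eq_abs, abs_of_pos (by positivity)]
  rw [h43, show ‖(4 : ℂ)‖ = 4 by simp]
  have hv1 : 0 < ‖v - 1‖ := norm_pos_iff.mpr (sub_ne_zero.mpr hv)
  have h43' : (0 : ℝ) < 4 * n + 3 := by positivity
  field_simp
  ring

/-- RH-FREE. **The circles `|v| = r_m`, `r_m = (4m+1)/(4m+5)` (`= ψ⁻¹(−2m−1)`, between the poles `x(m) < r_m <
x(m+1)`), stay at distance `≥ 1/5` from `2ℤ` under `ψ`** (for `m ≥ 1`): the disc version of the print's choice of
the contour `C_{R,m}` through `½ − 2m` avoiding the poles `−2n`.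
[cite: ConnesConsani2021QuasiInner, §2, contour `C_{R,m}` (arXiv chunk p0005:L53–L83)] -/
theorem dist_cayley_two_mul_int_ge {m : ℕ} (hm : 1 ≤ m) {v : ℂ}
    (hv : ‖v‖ = (4 * m + 1) / (4 * m + 5)) (j : ℤ) :
    (1 / 5 : ℝ) ≤ ‖cayley v - 2 * j‖ := by
  set r : ℝ := (4 * m + 1) / (4 * m + 5) with hr
  have hm' : (1 : ℝ) ≤ m := by exact_mod_cast hm
  have hr0 : 0 < r := by rw [hr]; positivity
  have hr1 : r < 1 := by rw [hr, div_lt_one (by positivity)]; linarith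
  have hvle : ‖v‖ ≤ 1 := by rw [hv]; exact hr1.le
  have hne : v ≠ 1 := by
    intro h; rw [h, norm_one] at hv; exact absurd hv.symm (ne_of_lt hr1)
  rcases le_or_gt 1 j with hj | hj
  · -- `j ≥ 1`: the real part alone gives `≥ 3/2`
    have hre := re_cayley_le hvle
    have h1 : |(cayley v - 2 * j).re| ≤ ‖cayley v - 2 * j‖ := Complex.abs_re_le_norm _
    have h2 : (cayley v - 2 * (j : ℂ)).re = (cayley v).re - 2 * j := by simp
    rw [h2] at h1
    have hj' : (1 : ℝ) ≤ j := by exact_mod_cast hj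
    have h3 : (3 / 2 : ℝ) ≤ |(cayley v).re - 2 * j| := by
      rw [abs_of_nonpos (by linarith)]; linarith
    linarith
  · -- `j = −n ≤ 0`: the pole `−2n = ψ(x(n))`
    obtain ⟨n, hn⟩ := Int.exists_eq_neg_ofNat (by omega : j ≤ 0)
    rw [hn]
    push_cast
    rw [show cayley v - 2 * -(n : ℂ) = cayley v + 2 * n by ring, norm_cayley_add_two_mul n hne]
    have hv1 : 0 < ‖v - 1‖ := norm_pos_iff.mpr (sub_ne_zero.mpr hne)
    -- it suffices: ‖v − x n‖/‖v − 1‖ ≥ 2/(5(4n+3))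
    have h43 : (0 : ℝ) < 4 * n + 3 := by positivity
    have key : 2 / (5 * (4 * (n : ℝ) + 3)) ≤ ‖v - xArch n‖ / ‖v - 1‖ := by
      have hm5 : (0:ℝ) < 4 * m + 5 := by positivity
      apply le_norm_sub_div_norm_sub_one hr0 hr1 hv (by positivity)
      · -- |r − x n|/(1 − r) = 2|2m − 2n + 1|/(4n+3) ≥ 2/(4n+3)
        have e1 : 1 - r = 4 / (4 * m + 5) := by rw [hr]; field_simp; ring
        have e2 : r - xArch n = 8 * (2 * m - 2 * n + 1) / ((4 * n + 3) * (4 * m + 5)) := by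
          rw [hr, xArch]; field_simp; ring
        have hodd : (1 : ℝ) ≤ |2 * (m : ℝ) - 2 * n + 1| := by
          have : (1 : ℤ) ≤ |2 * (m : ℤ) - 2 * n + 1| := Int.one_le_abs (by omega)
          exact_mod_cast this
        have e12 : |r - xArch n| / (1 - r) = 2 * |2 * (m : ℝ) - 2 * n + 1| / (4 * n + 3) := by
          rw [e1, e2, abs_div, abs_mul, abs_of_pos (by norm_num : (0:ℝ) < 8),
            abs_of_pos (by positivity : (0:ℝ) < (4 * n + 3) * (4 * m + 5))]
          field_simp
          ring
        rw [e12, div_le_div_iff₀ (by positivity) (by positivity)]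
        nlinarith [mul_nonneg h43.le (by linarith : (0:ℝ) ≤ 5 * |2 * (m : ℝ) - 2 * n + 1| - 1)]
      · -- (r + x n)/(1 + r) = (32mn + 8m + 24n − 2)/((4n+3)(8m+6)) ≥ 2/(5(4n+3))
        have e1 : 1 + r = (8 * m + 6) / (4 * m + 5) := by rw [hr]; field_simp; ring
        have e2 : r + xArch n = (32 * m * n + 8 * m + 24 * n - 2) / ((4 * n + 3) * (4 * m + 5)) := by
          rw [hr, xArch]; field_simp; ring
        have hn0 : (0:ℝ) ≤ n := n.cast_nonneg
        have hpos : (0 : ℝ) < 32 * m * n + 8 * m + 24 * n - 2 := by nlinarith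
        have e12 : |r + xArch n| / (1 + r) = (32 * m * n + 8 * m + 24 * n - 2) / ((4 * n + 3) * (8 * m + 6)) := by
          rw [e1, e2, abs_div, abs_of_pos hpos, abs_of_pos (by positivity : (0:ℝ) < (4 * n + 3) * (4 * m + 5))]
          field_simp
        rw [e12, div_le_div_iff₀ (by positivity) (by positivity)]
        have h8 : (0:ℝ) ≤ 160 * m * n + 24 * m + 120 * n - 22 := by nlinarith
        nlinarith [mul_nonneg h43.le h8]
    calc (1 / 5 : ℝ) = (4 * n + 3) / 2 * (2 / (5 * (4 * (n : ℝ) + 3))) := by field_simp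
      _ ≤ (4 * n + 3) / 2 * (‖v - xArch n‖ / ‖v - 1‖) := by gcongr
      _ = (4 * n + 3) * ‖v - xArch n‖ / (2 * ‖v - 1‖) := by ring


/-! ### D. Cauchy's theorem on the circles `|v| = r_m` and the limit `m → ∞` -/

/-- RH-FREE. `0 < r_m`. [folklore] -/
private theorem rArch_pos (m : ℕ) : (0:ℝ) < (4 * m + 1) / (4 * m + 5) := by positivity

/-- RH-FREE. `r_m < 1`. [folklore] -/
private theorem rArch_lt_one (m : ℕ) : ((4 * m + 1) / (4 * m + 5) : ℝ) < 1 := by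
  rw [div_lt_one (by positivity)]; linarith

/-- RH-FREE. `x(n) < r_m` for `n ≤ m`. [cite: ConnesConsani2021QuasiInner, §2 (p0005:L122)] -/
theorem xArch_lt_rArch {m n : ℕ} (h : n ≤ m) : xArch n < (4 * m + 1) / (4 * m + 5) := by
  have hn : (n:ℝ) ≤ m := by exact_mod_cast h
  rw [xArch, show (1:ℝ) - 4 / (4 * n + 3) = (4 * n - 1) / (4 * n + 3) by field_simp; ring,
    div_lt_div_iff₀ (by positivity) (by positivity)]
  nlinarith

/-- RH-FREE. `r_m < x(n)` for `n > m`. [cite: ConnesConsani2021QuasiInner, §2 (p0005:L122)] -/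
theorem rArch_lt_xArch {m n : ℕ} (h : m < n) : ((4 * m + 1) / (4 * m + 5) : ℝ) < xArch n := by
  have hn : (m:ℝ) + 1 ≤ n := by exact_mod_cast h
  rw [xArch, show (1:ℝ) - 4 / (4 * n + 3) = (4 * n - 1) / (4 * n + 3) by field_simp; ring,
    div_lt_div_iff₀ (by positivity) (by positivity)]
  nlinarith

/-- RH-FREE. `|x(n)| < r_m` for `n ≤ m`, `m ≥ 1` (the poles `x(0), …, x(m)` lie inside the circle `|v| = r_m`). [folklore] -/
private theorem abs_xArch_lt_rArch {m n : ℕ} (hm : 1 ≤ m) (h : n ≤ m) : |xArch n| < (4 * m + 1) / (4 * m + 5) := by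
  rw [abs_lt]
  refine ⟨?_, xArch_lt_rArch h⟩
  have hm' : (1:ℝ) ≤ m := by exact_mod_cast hm
  have h1 : -(1 / 3 : ℝ) ≤ xArch n := by
    rw [xArch]
    have : (4:ℝ) / (4 * n + 3) ≤ 4 / 3 :=
      div_le_div_of_nonneg_left (by norm_num) (by norm_num) (by linarith [n.cast_nonneg (α := ℝ)])
    linarith
  have h2 : (5 / 9 : ℝ) ≤ (4 * m + 1) / (4 * m + 5) := by
    rw [div_le_div_iff₀ (by norm_num) (by positivity)]; nlinarith
  linarith

/-- RH-FREE. No pole lies ON the circle `|v| = r_m`. [folklore] -/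
private theorem ne_xArch_of_norm_eq {m : ℕ} (hm : 1 ≤ m) {v : ℂ} (hv : ‖v‖ = (4 * m + 1) / (4 * m + 5)) (n : ℕ) :
    v ≠ xArch n := by
  intro h
  rw [h, Complex.norm_real, Real.norm_eq_abs] at hv
  rcases le_or_gt n m with hnm | hnm
  · exact absurd hv (abs_xArch_lt_rArch hm hnm).ne
  · have := rArch_lt_xArch hnm
    rw [← hv] at this
    exact absurd this (not_lt.mpr (le_abs_self _))

/-- RH-FREE. `|v| < 1 ⇒ v ≠ 1`. [folklore] -/
private theorem ne_one_of_norm_lt_one {v : ℂ} (hv : ‖v‖ < 1) : v ≠ 1 := by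
  intro h; rw [h, norm_one] at hv; exact lt_irrefl _ hv

/-- RH-FREE. **`κ` is uniformly bounded on the circles `|v| = r_m` (`m ≥ 1`)** — the disc form of the print's
control of `ρ_∞` on the contours `C_{R,m}`.
[cite: ConnesConsani2021QuasiInner, §2, estimates on `C_{R,m}` (arXiv chunk p0005:L59–L83)] -/
theorem exists_bound_kappaArch_circle :
    ∃ C : ℝ, 0 ≤ C ∧ ∀ m : ℕ, 1 ≤ m → ∀ v : ℂ, ‖v‖ = (4 * m + 1) / (4 * m + 5) → ‖kappaArch v‖ ≤ C := by
  obtain ⟨C, hC0, hC⟩ := exists_norm_rhoArch_le (by norm_num : (0:ℝ) < 1 / 5)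
  exact ⟨C, hC0, fun m hm v hv =>
    hC _ (re_cayley_le (by rw [hv]; exact (rArch_lt_one m).le)) (dist_cayley_two_mul_int_ge hm hv)⟩

open scoped Nat in
/-- RH-FREE. **Cauchy's theorem with the principal parts subtracted**: for `m ≥ 1` and `k ∈ ℕ`,
`∮_{|v| = r_m} κ(v) v^k dv = 2πi Σ_{n ≤ m} α(n) x(n)^k` — `κ(v)v^k − Σ_{n≤m} α(n)x(n)^k/(v − x(n))` extends
continuously across the poles `x(0), …, x(m)` (simple poles, residues `α(n)`), so its integral over the circle
vanishes (Cauchy–Goursat for the disc), while `∮ (v − x(n))⁻¹ dv = 2πi`.  This is the residue computation of the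
printed proof, `a_{−k} = −8 Σ Res_{z=−2n}(…)`, on the disc.
[cite: ConnesConsani2021QuasiInner, §2 «The residue formula gives» (arXiv chunk p0005:L93–L115)] -/
theorem circleIntegral_kappaArch_mul_pow {m : ℕ} (hm : 1 ≤ m) (k : ℕ) :
    (∮ v in C(0, (4 * m + 1) / (4 * m + 5)), kappaArch v * v ^ k) =
      2 * π * I * ∑ n ∈ Finset.range (m + 1), (alphaArch n : ℂ) * (xArch n : ℂ) ^ k := by
  set r : ℝ := (4 * m + 1) / (4 * m + 5) with hr
  have hr0 : 0 < r := rArch_pos m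
  have hr1 : r < 1 := rArch_lt_one m
  set S : Finset ℕ := Finset.range (m + 1) with hS
  set β : ℕ → ℂ := fun n => (alphaArch n : ℂ) * (xArch n : ℂ) ^ k with hβ
  set P : ℂ → ℂ := fun v => ∑ n ∈ S, β n / (v - xArch n) with hP
  set H₀ : ℂ → ℂ := fun v => kappaArch v * v ^ k - P v with hH₀
  set T : Set ℂ := (fun n : ℕ => (xArch n : ℂ)) '' (S : Set ℕ) with hT
  have hTfin : T.Finite := (S.finite_toSet).image _
  classical
  set H : ℂ → ℂ := T.piecewise (fun v => limUnder (𝓝[≠] v) H₀) H₀ with hH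
  have hmemT : ∀ {v : ℂ}, v ∈ T ↔ ∃ n, n ≤ m ∧ v = xArch n := by
    intro v
    simp only [hT, Set.mem_image, Finset.mem_coe, hS, Finset.mem_range]
    constructor
    · rintro ⟨n, hn, rfl⟩; exact ⟨n, by omega, rfl⟩
    · rintro ⟨n, hn, rfl⟩; exact ⟨n, by omega, rfl⟩
  -- (1) regular points of the closed disc
  have hreg : ∀ v : ℂ, ‖v‖ ≤ r → v ∉ T → (v ≠ 1 ∧ ∀ n : ℕ, v ≠ xArch n) := by
    intro v hv hvT
    refine ⟨ne_one_of_norm_lt_one (hv.trans_lt hr1), fun n hn => ?_⟩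
    rcases le_or_gt n m with h | h
    · exact hvT (hmemT.mpr ⟨n, h, hn⟩)
    · have h2 := rArch_lt_xArch h
      rw [hn, Complex.norm_real, Real.norm_eq_abs] at hv
      have h3 : xArch n ≤ r := (le_abs_self _).trans hv
      rw [hr] at h3
      linarith
  -- (2) `H₀` is differentiable at regular points
  have hH₀diff : ∀ v : ℂ, v ≠ 1 → (∀ n : ℕ, v ≠ xArch n) → DifferentiableAt ℂ H₀ v := by
    intro v hv1 hvx
    have h1 : DifferentiableAt ℂ (fun v => kappaArch v * v ^ k) v :=
      (differentiableAt_kappaArch hv1 hvx).mul (differentiableAt_pow k)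
    have h2 : DifferentiableAt ℂ P v := by
      simp only [hP]
      apply DifferentiableAt.fun_sum
      intro n _
      exact (differentiableAt_const _).div (differentiableAt_id.sub (differentiableAt_const _))
        (sub_ne_zero.mpr (hvx n))
    exact h1.sub h2
  -- (3) the limit of `H₀` at each pole `x(j)`, `j ≤ m`
  have hlimT : ∀ v ∈ T, ∃ L : ℂ, Tendsto H₀ (𝓝[≠] v) (𝓝 L) := by
    intro v hv
    obtain ⟨j, hj, rfl⟩ := hmemT.mp hv
    obtain ⟨L, hL⟩ := exists_tendsto_kappaArch_sub_pole j
    have hjS : j ∈ S := by rw [hS, Finset.mem_range]; omega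
    set Q : ℂ → ℂ := fun v => ∑ n ∈ S.erase j, β n / (v - xArch n) with hQ
    have hQcont : ContinuousAt Q (xArch j : ℂ) := by
      have : DifferentiableAt ℂ Q (xArch j : ℂ) := by
        simp only [hQ]
        apply DifferentiableAt.fun_sum
        intro n hn
        have hne : n ≠ j := (Finset.mem_erase.mp hn).1
        have hx : (xArch j : ℂ) ≠ xArch n := by
          intro h
          have h' : xArch j = xArch n := by exact_mod_cast h
          simp only [xArch] at h'
          have : (4 * (j : ℝ) + 3) = 4 * n + 3 := by
            have h43j : (4 * (j:ℝ) + 3) ≠ 0 := by positivity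
            have h43n : (4 * (n:ℝ) + 3) ≠ 0 := by positivity
            field_simp at h'
            linarith
          have : (j : ℝ) = n := by linarith
          exact hne (by exact_mod_cast this.symm)
        exact (differentiableAt_const _).div (differentiableAt_id.sub (differentiableAt_const _))
          (sub_ne_zero.mpr hx)
      exact this.continuousAt
    have hslope : Tendsto (slope (fun v : ℂ => v ^ k) (xArch j : ℂ)) (𝓝[≠] (xArch j : ℂ))
        (𝓝 ((k : ℂ) * (xArch j : ℂ) ^ (k - 1))) :=
      hasDerivAt_iff_tendsto_slope.mp (hasDerivAt_pow k _)
    have hpow : Tendsto (fun v : ℂ => v ^ k) (𝓝[≠] (xArch j : ℂ)) (𝓝 ((xArch j : ℂ) ^ k)) :=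
      ((continuous_pow k).tendsto _).mono_left nhdsWithin_le_nhds
    refine ⟨L * (xArch j : ℂ) ^ k + (alphaArch j : ℂ) * ((k : ℂ) * (xArch j : ℂ) ^ (k - 1)) - Q (xArch j), ?_⟩
    have hlim := ((hL.mul hpow).add (hslope.const_mul (alphaArch j : ℂ))).sub
      (hQcont.tendsto.mono_left nhdsWithin_le_nhds)
    refine hlim.congr' ?_
    filter_upwards [self_mem_nhdsWithin] with v hv
    have hv' : v - xArch j ≠ 0 := sub_ne_zero.mpr hv
    simp only [hH₀, hP, hQ, slope_def_field]
    rw [Finset.sum_erase_eq_sub hjS]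
    field_simp
    ring
  -- (4) `H` agrees with `H₀` off `T`, is continuous on the closed disc and differentiable off `T`
  have hH_eq : ∀ v, v ∉ T → H =ᶠ[𝓝 v] H₀ := by
    intro v hv
    have : Tᶜ ∈ 𝓝 v := hTfin.isClosed.isOpen_compl.mem_nhds hv
    filter_upwards [this] with w hw
    exact Set.piecewise_eq_of_notMem _ _ _ hw
  have hHcont : ContinuousOn H (closedBall 0 r) := by
    intro v hv
    rw [mem_closedBall, dist_zero_right] at hv
    apply ContinuousAt.continuousWithinAt
    by_cases hvT : v ∈ T
    · obtain ⟨L, hL⟩ := hlimT v hvT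
      have hHv : H v = L := by
        rw [hH, Set.piecewise_eq_of_mem _ _ _ hvT]; exact hL.limUnder_eq
      have hev : ∀ᶠ w in 𝓝[≠] v, H w = H₀ w := by
        have hcl : (T \ {v})ᶜ ∈ 𝓝 v := (hTfin.subset fun x hx => hx.1).isClosed.isOpen_compl.mem_nhds (by simp)
        filter_upwards [mem_nhdsWithin_of_mem_nhds hcl, self_mem_nhdsWithin] with w hw hwv
        apply Set.piecewise_eq_of_notMem
        intro hwT
        exact hw ⟨hwT, hwv⟩
      rw [← continuousWithinAt_compl_self, ContinuousWithinAt, hHv]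
      exact hL.congr' (hev.mono fun w hw => hw.symm)
    · obtain ⟨hv1, hvx⟩ := hreg v hv hvT
      exact (hH₀diff v hv1 hvx).continuousAt.congr (hH_eq v hvT).symm
  have hHdiff : ∀ z ∈ ball (0:ℂ) r \ T, DifferentiableAt ℂ H z := by
    rintro z ⟨hz, hzT⟩
    rw [mem_ball, dist_zero_right] at hz
    obtain ⟨hz1, hzx⟩ := hreg z hz.le hzT
    exact (hH₀diff z hz1 hzx).congr_of_eventuallyEq (hH_eq z hzT)
  -- (5) Cauchy–Goursat
  have hCG := Complex.circleIntegral_eq_zero_of_differentiable_on_off_countable hr0.le hTfin.countable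
    hHcont hHdiff
  -- (6) no pole on the circle: `∮ H = ∮ H₀`
  have hsphere : ∀ v ∈ sphere (0:ℂ) r, v ∉ T ∧ v ≠ 1 ∧ ∀ n : ℕ, v ≠ xArch n := by
    intro v hv
    rw [mem_sphere, dist_zero_right] at hv
    have hvx : ∀ n : ℕ, v ≠ xArch n := fun n => ne_xArch_of_norm_eq hm hv n
    refine ⟨fun hT' => ?_, ne_one_of_norm_lt_one (hv ▸ hr1), hvx⟩
    obtain ⟨n, -, hn⟩ := hmemT.mp hT'
    exact hvx n hn
  have hint : (∮ v in C(0, r), H v) = ∮ v in C(0, r), H₀ v :=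
    circleIntegral.integral_congr hr0.le fun v hv => Set.piecewise_eq_of_notMem _ _ _ (hsphere v hv).1
  -- (7) `∮ H₀ = ∮ κ v^k − 2πi Σ β`
  have hcontκ : ContinuousOn (fun v => kappaArch v * v ^ k) (sphere (0:ℂ) r) := fun v hv =>
    ((differentiableAt_kappaArch (hsphere v hv).2.1 (hsphere v hv).2.2).mul
      (differentiableAt_pow k)).continuousAt.continuousWithinAt
  have hiκ : CircleIntegrable (fun v => kappaArch v * v ^ k) 0 r := hcontκ.circleIntegrable hr0.le
  have hiterm : ∀ n ∈ S, CircleIntegrable (fun v => β n / (v - xArch n)) 0 r := by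
    intro n _
    apply ContinuousOn.circleIntegrable hr0.le
    intro v hv
    have hne : v - (xArch n : ℂ) ≠ 0 := sub_ne_zero.mpr ((hsphere v hv).2.2 n)
    exact (continuousAt_const.div (continuousAt_id.sub continuousAt_const) hne).continuousWithinAt
  have hiP : CircleIntegrable P 0 r := by
    simp only [hP]
    exact CircleIntegrable.fun_sum S hiterm
  have hPint : (∮ v in C(0, r), P v) = ∑ n ∈ S, β n * (2 * π * I) := by
    simp only [hP]
    rw [circleIntegral.integral_fun_sum hiterm]
    apply Finset.sum_congr rfl
    intro n hn
    have hnm : n ≤ m := by rw [hS, Finset.mem_range] at hn; omega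
    have hmem : (xArch n : ℂ) ∈ ball (0:ℂ) r := by
      rw [mem_ball, dist_zero_right, Complex.norm_real, Real.norm_eq_abs]
      exact abs_xArch_lt_rArch hm hnm
    simp_rw [div_eq_mul_inv]
    rw [circleIntegral.integral_const_mul, circleIntegral.integral_sub_inv_of_mem_ball hmem]
  have hH₀int : (∮ v in C(0, r), H₀ v) =
      (∮ v in C(0, r), kappaArch v * v ^ k) - ∑ n ∈ S, β n * (2 * π * I) := by
    rw [← hPint]
    exact circleIntegral.integral_sub hiκ hiP
  rw [hint, hH₀int] at hCG
  rw [sub_eq_zero.mp hCG, Finset.mul_sum]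
  exact Finset.sum_congr rfl fun n _ => by simp only [hβ]; ring


/-- RH-FREE. **The negative Fourier coefficients of `κ|S¹` as contour integrals**: `a_{−(k+1)} =
(2πi)⁻¹ ∮_{|v|=1} κ(v) v^k dv` («`a_{−k} = (1/2π)∫κ(e^{iθ})e^{ikθ}dθ = (1/2πi)∫_{S¹} κ(v)v^{k−1}dv`»).
[cite: ConnesConsani2021QuasiInner, §2 display after «With S¹ the positively oriented circle» (arXiv chunk p0005:L31–L36)] -/
theorem fourierCoeff_kappaArch_eq_circleIntegral (k : ℕ) :
    fourierCoeff (T := 1) (circleRestrict 1 kappaArch) (-(k + 1 : ℤ)) =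
      (2 * π * I)⁻¹ * ∮ v in C(0, 1), kappaArch v * v ^ k := by
  rw [fourierCoeff_eq_intervalIntegral _ _ 0, zero_add, neg_neg, div_self one_ne_zero, one_smul]
  have hL : ∀ x : ℝ, @fourier 1 (k + 1 : ℤ) (x : AddCircle (1:ℝ)) • circleRestrict 1 kappaArch (x : AddCircle (1:ℝ)) =
      Complex.exp (2 * π * x * I) ^ (k + 1) * kappaArch (Complex.exp (2 * π * x * I)) := by
    intro x
    rw [fourier_coe_apply, circleRestrict, AddCircle.toCircle_apply_mk, Circle.coe_exp, smul_eq_mul,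
      ← Complex.exp_nat_mul]
    congr 2
    · push_cast; ring
    · push_cast; ring_nf
  simp_rw [hL]
  have hR : (∮ v in C(0, 1), kappaArch v * v ^ k) = ∫ θ in (0:ℝ)..2 * π,
      Complex.exp (θ * I) * I * (kappaArch (Complex.exp (θ * I)) * Complex.exp (θ * I) ^ k) := by
    simp only [circleIntegral, deriv_circleMap, circleMap_zero, smul_eq_mul, ofReal_one, one_mul]
  rw [hR]
  have hcv := intervalIntegral.integral_comp_mul_left
    (fun θ : ℝ => Complex.exp (θ * I) * I * (kappaArch (Complex.exp (θ * I)) * Complex.exp (θ * I) ^ k))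
    (c := 2 * π) (a := 0) (b := 1) Real.two_pi_pos.ne'
  rw [mul_zero, mul_one] at hcv
  -- hcv : ∫ x in 0..1, F (2πx) = (2π)⁻¹ • ∫ θ in 0..2π, F θ
  have h2 : (∫ θ in (0:ℝ)..2 * π, Complex.exp (θ * I) * I * (kappaArch (Complex.exp (θ * I)) * Complex.exp (θ * I) ^ k))
      = (2 * π : ℝ) • ∫ x in (0:ℝ)..1, Complex.exp (↑(2 * π * x) * I) * I *
          (kappaArch (Complex.exp (↑(2 * π * x) * I)) * Complex.exp (↑(2 * π * x) * I) ^ k) := by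
    rw [hcv, smul_smul, mul_inv_cancel₀ Real.two_pi_pos.ne', one_smul]
  rw [h2, Complex.real_smul]
  have h3 : (∫ x in (0:ℝ)..1, Complex.exp (↑(2 * π * x) * I) * I *
      (kappaArch (Complex.exp (↑(2 * π * x) * I)) * Complex.exp (↑(2 * π * x) * I) ^ k)) =
      I * ∫ x in (0:ℝ)..1, Complex.exp (2 * π * x * I) ^ (k + 1) * kappaArch (Complex.exp (2 * π * x * I)) := by
    rw [← intervalIntegral.integral_const_mul]
    apply intervalIntegral.integral_congr
    intro x _
    push_cast
    ring
  rw [h3]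
  have hI : I ≠ 0 := I_ne_zero
  have hπ : (π : ℂ) ≠ 0 := ofReal_ne_zero.mpr Real.pi_ne_zero
  push_cast
  field_simp
  refine intervalIntegral.integral_congr fun x _ => ?_
  rw [show (2 * (π : ℂ) * I * (x : ℂ)) = 2 * π * x * I by ring]

/-- RH-FREE. `r_m → 1`. [folklore] -/
private theorem tendsto_rArch : Tendsto (fun m : ℕ => ((4 * (m : ℝ) + 1) / (4 * m + 5))) atTop (𝓝 1) := by
  have h1 : Tendsto (fun m : ℕ => (4 * (m : ℝ) + 5)) atTop atTop :=
    tendsto_atTop_add_const_right _ _ (tendsto_natCast_atTop_atTop.const_mul_atTop (by norm_num))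
  have h2 : Tendsto (fun m : ℕ => (4 : ℝ) / (4 * m + 5)) atTop (𝓝 0) := tendsto_const_nhds.div_atTop h1
  have h3 := tendsto_const_nhds (x := (1:ℝ)) |>.sub h2
  rw [sub_zero] at h3
  refine h3.congr fun m => ?_
  have : (4 * (m : ℝ) + 5) ≠ 0 := by positivity
  field_simp
  ring

/-- RH-FREE. **The limit `m → ∞` of the contour integrals** (bounded convergence: `κ` is uniformly bounded on the
circles `|v| = r_m` and continuous on `S¹ ∖ {1}`): `∮_{|v|=r_m} κ(v)v^k dv → ∮_{|v|=1} κ(v)v^k dv` — the disc form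
of the passage `R, m → ∞` of the printed proof.
[cite: ConnesConsani2021QuasiInner, §2 «Thus we obtain … with an error term of the form ε(m)+O(1/R)» (arXiv chunk p0005:L85–L92)] -/
theorem tendsto_circleIntegral_kappaArch (k : ℕ) :
    Tendsto (fun m : ℕ => ∮ v in C(0, (4 * m + 1) / (4 * m + 5)), kappaArch v * v ^ k) atTop
      (𝓝 (∮ v in C(0, 1), kappaArch v * v ^ k)) := by
  obtain ⟨C, hC0, hC⟩ := exists_bound_kappaArch_circle
  simp only [circleIntegral, deriv_circleMap]
  refine intervalIntegral.tendsto_integral_filter_of_dominated_convergence (fun _ => C) ?_ ?_ ?_ ?_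
  · filter_upwards [eventually_ge_atTop 1] with m hm
    apply Continuous.aestronglyMeasurable
    have hκ : Continuous fun θ : ℝ => kappaArch (circleMap 0 ((4 * m + 1) / (4 * m + 5)) θ) := by
      refine continuous_iff_continuousAt.mpr fun θ => ?_
      have hv : ‖circleMap 0 ((4 * (m:ℝ) + 1) / (4 * m + 5)) θ‖ = (4 * m + 1) / (4 * m + 5) := by
        rw [norm_circleMap_zero, abs_of_pos (rArch_pos m)]
      exact (differentiableAt_kappaArch (ne_one_of_norm_lt_one (by rw [hv]; exact rArch_lt_one m))
        (ne_xArch_of_norm_eq hm hv)).continuousAt.comp (continuous_circleMap 0 _).continuousAt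
    exact ((continuous_circleMap 0 _).mul continuous_const).smul
      (hκ.mul ((continuous_circleMap 0 _).pow k))
  · filter_upwards [eventually_ge_atTop 1] with m hm
    refine ae_of_all _ fun θ _ => ?_
    have hv : ‖circleMap 0 ((4 * (m:ℝ) + 1) / (4 * m + 5)) θ‖ = (4 * m + 1) / (4 * m + 5) := by
      rw [norm_circleMap_zero, abs_of_pos (rArch_pos m)]
    have h1 := hC m hm _ hv
    have hr1 := (rArch_lt_one m).le
    have hr0 := (rArch_pos m).le
    rw [norm_smul, norm_mul, norm_I, mul_one, norm_mul, norm_pow, hv]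
    have hk : ((4 * (m:ℝ) + 1) / (4 * m + 5)) ^ k ≤ 1 := pow_le_one₀ hr0 hr1
    calc _ ≤ 1 * (C * 1) := by gcongr
      _ = C := by ring
  · exact intervalIntegrable_const
  · have h2π : ∀ᵐ θ : ℝ, θ ∉ ({2 * π} : Set ℝ) := compl_mem_ae_iff.mpr Real.volume_singleton
    filter_upwards [h2π] with θ hθ hmem
    rw [uIoc_of_le Real.two_pi_pos.le] at hmem
    have hθ2 : θ ≠ 2 * π := hθ
    have hθlt : θ < 2 * π := lt_of_le_of_ne hmem.2 hθ2
    have hexp1 : Complex.exp (θ * I) ≠ 1 := by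
      intro h
      obtain ⟨n, hn⟩ := Complex.exp_eq_one_iff.mp h
      have hre := congrArg Complex.im hn
      simp at hre
      -- θ = n * 2π with 0 < θ < 2π
      have h1 : (0:ℝ) < n := by
        have : (0:ℝ) < n * (2 * π) := by rw [← hre]; exact hmem.1
        nlinarith [Real.pi_pos]
      have h2 : (n:ℝ) < 1 := by
        have : (n:ℝ) * (2 * π) < 1 * (2 * π) := by rw [← hre, one_mul]; exact hθlt
        nlinarith [Real.pi_pos]
      have h1' : (0:ℤ) < n := by exact_mod_cast h1
      have h2' : n < (1:ℤ) := by exact_mod_cast h2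
      omega
    have hcm : Tendsto (fun m : ℕ => circleMap 0 ((4 * (m:ℝ) + 1) / (4 * m + 5)) θ) atTop
        (𝓝 (circleMap 0 1 θ)) := by
      simp only [circleMap_zero]
      refine Tendsto.mul ?_ tendsto_const_nhds
      have h := (Complex.continuous_ofReal.tendsto 1).comp tendsto_rArch
      rw [Complex.ofReal_one] at h
      refine h.congr fun m => ?_
      simp only [Function.comp_apply]
    have hv1 : ‖circleMap 0 (1:ℝ) θ‖ = 1 := by rw [norm_circleMap_zero, abs_one]
    have hne1 : circleMap 0 (1:ℝ) θ ≠ 1 := by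
      simpa [circleMap_zero] using hexp1
    have hnx : ∀ n : ℕ, circleMap 0 (1:ℝ) θ ≠ xArch n := by
      intro n h
      have := xArch_lt_one n
      rw [h, Complex.norm_real, Real.norm_eq_abs] at hv1
      rw [hv1] at this
      exact lt_irrefl _ this
    have hκ : ContinuousAt kappaArch (circleMap 0 1 θ) := (differentiableAt_kappaArch hne1 hnx).continuousAt
    exact (hcm.mul tendsto_const_nhds).smul ((hκ.tendsto.comp hcm).mul (hcm.pow k))

open scoped Nat in
/-- RH-FREE. The coefficient series `Σ_n α(n) x(n)^k` converges absolutely («the series α(n) is summable and tends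
to 0 extremely fast»). [cite: ConnesConsani2021QuasiInner, §2 (arXiv chunk p0005:L122)] -/
theorem summable_alphaArch_mul_pow (k : ℕ) : Summable fun n : ℕ => alphaArch n * xArch n ^ k := by
  have h1 : Summable fun n : ℕ => (2 * π) ^ n / n ! := Real.summable_pow_div_factorial (2 * π)
  have h2 : Summable fun n : ℕ => (2 * π) ^ (2 * n) / (2 * n)! := by
    have := h1.comp_injective (mul_right_injective₀ (two_ne_zero (α := ℕ)))
    exact this
  refine Summable.of_norm_bounded (h2.mul_left 16) fun n => ?_
  rw [Real.norm_eq_abs, abs_mul, abs_pow, alphaArch_eq]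
  have hx : |xArch n| ^ k ≤ 1 := pow_le_one₀ (abs_nonneg _) (xArch_lt_one n).le
  have h43 : (1:ℝ) ≤ (4 * n + 3) ^ 2 := by nlinarith [n.cast_nonneg (α := ℝ)]
  have hfac : (0:ℝ) < (2 * n)! := by positivity
  have hpow : (0:ℝ) < (2 * π) ^ (2 * n) := by positivity
  rw [abs_div, abs_mul, abs_mul, abs_pow, abs_neg, abs_one, one_pow, one_mul,
    abs_of_pos (by norm_num : (0:ℝ) < 16), abs_of_pos hpow,
    abs_of_pos (by positivity : (0:ℝ) < (2 * n)! * (4 * n + 3) ^ 2)]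
  calc 16 * (2 * π) ^ (2 * n) / ((2 * n)! * (4 * (n:ℝ) + 3) ^ 2) * |xArch n| ^ k
      ≤ 16 * (2 * π) ^ (2 * n) / ((2 * n)! * 1) * 1 := by
        apply mul_le_mul _ hx (by positivity) (by positivity)
        apply div_le_div_of_nonneg_left (by positivity) (by positivity)
        exact mul_le_mul_of_nonneg_left h43 hfac.le
    _ = 16 * ((2 * π) ^ (2 * n) / (2 * n)!) := by ring

/-- RH-FREE. `Σ_n α(n) x(n)^k = a_{−(k+1)}` (definition of `archNegCoeff`). [cite: ConnesConsani2021QuasiInner, §2 display «aminusk» (p0005:L115)] -/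
theorem hasSum_archNegCoeff (k : ℕ) :
    HasSum (fun n : ℕ => alphaArch n * xArch n ^ k) (archNegCoeff (k + 1)) := by
  have := (summable_alphaArch_mul_pow k).hasSum
  simpa [archNegCoeff] using this


/-! ### E. Proposition 2.4 — `κ ∈ C^∞(S¹) + H^∞(𝒰)`: the pole part `πκ` and the bounded holomorphic remainder

Print (p0006:L91–p0007:L8): «We isolate the pole part of ρ_∞ … πρ_∞(z) := Σ Res_{z=−2n}(ρ_∞) (z+2n)⁻¹ …
πκ := πρ_∞ ∘ ψ … πκ ∈ C^∞(S¹) (the series of m-th derivatives of the terms converges absolutely) … the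
function k(v) := κ(v) − πκ(v), by construction holomorphic in 𝒰, … is bounded and thus belongs to H^∞(𝒰)».
We use the pole part in the form `G(v) := Σ_n α(n)/(v − x(n))` (`= πκ(v) − Σ_n Res_n·2/(4n+3)`, a constant
shift, by `inv_cayley_add_two_mul`), so that `c(x) := G(e^{2πix})` and `h := κ − G` (regularised at the poles)
give the typed decomposition. -/

/-- RH-FREE. `x(n) → 1` («the x(n) increase to 1»). [cite: ConnesConsani2021QuasiInner, §2 (arXiv chunk p0005:L122)] -/
theorem tendsto_xArch : Tendsto (fun n : ℕ => (xArch n : ℂ)) atTop (𝓝 1) := by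
  have h1 : Tendsto (fun n : ℕ => (4 * (n : ℝ) + 3)) atTop atTop :=
    tendsto_atTop_add_const_right _ _ (tendsto_natCast_atTop_atTop.const_mul_atTop (by norm_num))
  have h2 : Tendsto (fun n : ℕ => (4 : ℝ) / (4 * n + 3)) atTop (𝓝 0) := tendsto_const_nhds.div_atTop h1
  have h3 : Tendsto (fun n : ℕ => xArch n) atTop (𝓝 1) := by
    have := tendsto_const_nhds (x := (1:ℝ)) |>.sub h2
    rw [sub_zero] at this
    refine this.congr fun n => ?_
    simp [xArch]
  have := (Complex.continuous_ofReal.tendsto 1).comp h3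
  rwa [Complex.ofReal_one] at this

/-- RH-FREE. The closed set of poles of `κ` together with their limit point `1` («the x(n) increase to 1»).
[cite: ConnesConsani2021QuasiInner, §2 (arXiv chunk p0005:L122)] -/
theorem isClosed_insert_one_range_xArch :
    IsClosed (insert (1:ℂ) (Set.range fun n : ℕ => (xArch n : ℂ))) :=
  (tendsto_xArch.isCompact_insert_range).isClosed

/-- RH-FREE. `Σ |α(n)| < ∞`. [cite: ConnesConsani2021QuasiInner, §2 «the series α(n) is summable» (arXiv chunk p0005:L122)] -/
theorem summable_abs_alphaArch : Summable fun n : ℕ => |alphaArch n| := by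
  have := (summable_alphaArch_mul_pow 0).abs
  simpa using this

/-- RH-FREE. The pole part `G(v) = Σ_n α(n)/(v − x(n))` is holomorphic on the open set `{v : d < dist(v, poles ∪ {1})}`
(uniform convergence: terms bounded by `|α(n)|/d`).
[cite: ConnesConsani2021QuasiInner, Prop 2.4 proof, display «piom»/«pikap» (arXiv chunk p0006:L91–L104)] -/
theorem differentiableOn_poleSum_of_pos {d : ℝ} (hd : 0 < d) :
    DifferentiableOn ℂ (fun v : ℂ => ∑' n : ℕ, (alphaArch n : ℂ) / (v - xArch n))
      {v : ℂ | d < Metric.infDist v (insert (1:ℂ) (Set.range fun n : ℕ => (xArch n : ℂ)))} := by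
  set S := insert (1:ℂ) (Set.range fun n : ℕ => (xArch n : ℂ)) with hS
  have hmemS : ∀ n : ℕ, (xArch n : ℂ) ∈ S := fun n => mem_insert_of_mem _ (mem_range_self n)
  have hdist : ∀ n : ℕ, ∀ v ∈ {v : ℂ | d < Metric.infDist v S}, d ≤ ‖v - xArch n‖ := by
    intro n v hv
    have h1 : d < infDist v S := hv
    have h2 := infDist_le_dist_of_mem (x := v) (hmemS n)
    rw [dist_eq_norm] at h2
    linarith
  refine differentiableOn_tsum_of_summable_norm (u := fun n => |alphaArch n| / d)
    (summable_abs_alphaArch.div_const d) (fun n => ?_) (isOpen_lt continuous_const (continuous_infDist_pt _))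
    (fun n v hv => ?_)
  · apply DifferentiableOn.div (differentiableOn_const _) (differentiableOn_id.sub (differentiableOn_const _))
    intro v hv h0
    have := hdist n v hv
    rw [h0, norm_zero] at this
    linarith
  · have h := hdist n v hv
    rw [norm_div, Complex.norm_real, Real.norm_eq_abs]
    exact div_le_div_of_nonneg_left (abs_nonneg _) hd h

/-- RH-FREE. The pole part `G` is holomorphic (in particular continuous) at every point off the poles and off `v = 1`.
[cite: ConnesConsani2021QuasiInner, Prop 2.4 proof (arXiv chunk p0006:L91–L104)] -/
theorem differentiableAt_poleSum {v : ℂ} (hv : v ∉ insert (1:ℂ) (Set.range fun n : ℕ => (xArch n : ℂ))) :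
    DifferentiableAt ℂ (fun v : ℂ => ∑' n : ℕ, (alphaArch n : ℂ) / (v - xArch n)) v := by
  set S := insert (1:ℂ) (Set.range fun n : ℕ => (xArch n : ℂ)) with hS
  have hpos : 0 < infDist v S :=
    (isClosed_insert_one_range_xArch.notMem_iff_infDist_pos ⟨1, mem_insert _ _⟩).mp hv
  have hmem : v ∈ {w : ℂ | infDist v S / 2 < infDist w S} := by
    show infDist v S / 2 < infDist v S
    linarith
  exact (differentiableOn_poleSum_of_pos (half_pos hpos)).differentiableAt
    ((isOpen_lt continuous_const (continuous_infDist_pt _)).mem_nhds hmem)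

/-- RH-FREE. The elementary inequality behind the uniform bound of the pole part on the circles `|v| = r_m`:
`4m + 5 ≤ 2(4n+3)|2m − 2n + 1|`. [cite: ConnesConsani2021QuasiInner, Prop 2.4 proof «fast convergence of the series (piom)» (arXiv chunk p0007:L23)] -/
theorem four_mul_add_five_le (m n : ℕ) :
    (4 * (m:ℝ) + 5) ≤ 2 * (4 * n + 3) * |2 * (m:ℝ) - 2 * n + 1| := by
  have hn : (0:ℝ) ≤ n := n.cast_nonneg
  rcases le_or_gt (2 * n) m with h | h
  · have h' : (2:ℝ) * n ≤ m := by exact_mod_cast h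
    rw [abs_of_pos (by linarith)]
    nlinarith
  · have h' : (m:ℝ) + 1 ≤ 2 * n := by exact_mod_cast h
    have h1 : (1:ℝ) ≤ |2 * (m:ℝ) - 2 * n + 1| := by
      have : (1 : ℤ) ≤ |2 * (m : ℤ) - 2 * n + 1| := Int.one_le_abs (by omega)
      exact_mod_cast this
    nlinarith

open scoped Nat in
/-- RH-FREE. `|α(n)|` in closed form. [cite: ConnesConsani2021QuasiInner, §2 display «aminusk» (arXiv chunk p0005:L115)] -/
theorem abs_alphaArch (n : ℕ) : |alphaArch n| = 16 * (2 * π) ^ (2 * n) / ((2 * n)! * (4 * (n:ℝ) + 3) ^ 2) := by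
  rw [alphaArch_eq, abs_div, abs_mul, abs_mul, abs_pow, abs_neg, abs_one, one_pow, one_mul,
    abs_of_pos (by norm_num : (0:ℝ) < 16), abs_of_pos (by positivity : (0:ℝ) < (2 * π) ^ (2 * n)),
    abs_of_pos (by positivity : (0:ℝ) < (2 * n)! * (4 * n + 3) ^ 2)]

open scoped Nat in
/-- RH-FREE. **Termwise bound of the pole part on the circle `|v| = r_m`**, uniform in `m ≥ 1`:
`|α(n)|/|v − x(n)| ≤ 8(2π)^{2n}/(2n)!`. [cite: ConnesConsani2021QuasiInner, Prop 2.4 proof «fast convergence of the series (piom) to bound |πω_∞(z)|» (arXiv chunk p0007:L23)] -/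
theorem norm_alphaArch_div_sub_le {m : ℕ} (hm : 1 ≤ m) {v : ℂ} (hv : ‖v‖ = (4 * m + 1) / (4 * m + 5)) (n : ℕ) :
    ‖(alphaArch n : ℂ) / (v - xArch n)‖ ≤ 8 * (2 * π) ^ (2 * n) / (2 * n)! := by
  have hm' : (1:ℝ) ≤ m := by exact_mod_cast hm
  rw [norm_div, Complex.norm_real, Real.norm_eq_abs]
  rcases Nat.eq_zero_or_pos n with rfl | hn
  · have hα : |alphaArch 0| = 16 / 9 := by rw [abs_alphaArch]; norm_num
    have hx0 : ‖((xArch 0 : ℝ) : ℂ)‖ = 1 / 3 := by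
      rw [Complex.norm_real, Real.norm_eq_abs, xArch]; norm_num
    have hr : (5 / 9 : ℝ) ≤ (4 * m + 1) / (4 * m + 5) := by
      rw [div_le_div_iff₀ (by norm_num) (by positivity)]; nlinarith
    have hvx : (2 / 9 : ℝ) ≤ ‖v - xArch 0‖ := by
      have := norm_sub_norm_le v ((xArch 0 : ℝ) : ℂ)
      rw [hv, hx0] at this
      linarith
    rw [hα]
    calc (16 / 9 : ℝ) / ‖v - ↑(xArch 0)‖ ≤ (16 / 9) / (2 / 9) :=
          div_le_div_of_nonneg_left (by norm_num) (by norm_num) hvx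
      _ = 8 * (2 * π) ^ (2 * 0) / (2 * 0)! := by norm_num
  · have h43 : (0:ℝ) < 4 * n + 3 := by positivity
    have hm5 : (0:ℝ) < 4 * m + 5 := by positivity
    have hn1 : (1:ℝ) ≤ n := by exact_mod_cast hn
    have hxn : 0 ≤ xArch n := by
      rw [xArch]
      have : (4:ℝ) / (4 * n + 3) ≤ 1 := by rw [div_le_one h43]; linarith
      linarith
    have hvx : |(4 * (m:ℝ) + 1) / (4 * m + 5) - xArch n| ≤ ‖v - xArch n‖ := by
      have := abs_norm_sub_norm_le v ((xArch n : ℝ) : ℂ)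
      rw [hv, Complex.norm_real, Real.norm_eq_abs, abs_of_nonneg hxn] at this
      exact this
    have e2 : (4 * (m:ℝ) + 1) / (4 * m + 5) - xArch n = 8 * (2 * m - 2 * n + 1) / ((4 * n + 3) * (4 * m + 5)) := by
      rw [xArch]; field_simp; ring
    have hodd : (1 : ℝ) ≤ |2 * (m : ℝ) - 2 * n + 1| := by
      have : (1 : ℤ) ≤ |2 * (m : ℤ) - 2 * n + 1| := Int.one_le_abs (by omega)
      exact_mod_cast this
    have hkpos : (0:ℝ) < |2 * (m : ℝ) - 2 * n + 1| := by linarith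
    have habs : |(4 * (m:ℝ) + 1) / (4 * m + 5) - xArch n| =
        8 * |2 * (m:ℝ) - 2 * n + 1| / ((4 * n + 3) * (4 * m + 5)) := by
      rw [e2, abs_div, abs_mul, abs_of_pos (by norm_num : (0:ℝ) < 8),
        abs_of_pos (by positivity : (0:ℝ) < (4 * n + 3) * (4 * m + 5))]
    rw [habs] at hvx
    have hkey := four_mul_add_five_le m n
    rw [abs_alphaArch]
    calc 16 * (2 * π) ^ (2 * n) / ((2 * n)! * (4 * (n:ℝ) + 3) ^ 2) / ‖v - ↑(xArch n)‖
        ≤ 16 * (2 * π) ^ (2 * n) / ((2 * n)! * (4 * (n:ℝ) + 3) ^ 2) /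
            (8 * |2 * (m:ℝ) - 2 * n + 1| / ((4 * n + 3) * (4 * m + 5))) :=
          div_le_div_of_nonneg_left (by positivity) (by positivity) hvx
      _ = 2 * (2 * π) ^ (2 * n) / (2 * n)! * ((4 * m + 5) / ((4 * n + 3) * |2 * (m:ℝ) - 2 * n + 1|)) := by
          field_simp
          ring
      _ ≤ 2 * (2 * π) ^ (2 * n) / (2 * n)! * 2 := by
          gcongr
          rw [div_le_iff₀ (by positivity)]
          linarith
      _ ≤ 8 * (2 * π) ^ (2 * n) / (2 * n)! := by
          have : (0:ℝ) ≤ (2 * π) ^ (2 * n) / (2 * n)! := by positivity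
          rw [show (8:ℝ) * (2 * π) ^ (2 * n) / ↑(2 * n)! = 8 * ((2 * π) ^ (2 * n) / ↑(2 * n)!) by ring,
            show (2:ℝ) * (2 * π) ^ (2 * n) / ↑(2 * n)! * 2 = 4 * ((2 * π) ^ (2 * n) / ↑(2 * n)!) by ring]
          linarith

open scoped Nat in
/-- RH-FREE. The majorant series `Σ 8(2π)^{2n}/(2n)!` converges. [cite: ConnesConsani2021QuasiInner, Prop 2.4 proof (arXiv chunk p0007:L23)] -/
theorem summable_poleSum_majorant : Summable fun n : ℕ => 8 * (2 * π) ^ (2 * n) / (2 * n)! := by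
  have h1 : Summable fun n : ℕ => (2 * π) ^ n / n ! := Real.summable_pow_div_factorial (2 * π)
  have h2 : Summable fun n : ℕ => (2 * π) ^ (2 * n) / (2 * n)! :=
    h1.comp_injective (mul_right_injective₀ (two_ne_zero (α := ℕ)))
  refine (h2.mul_left 8).congr fun n => ?_
  ring

open scoped Nat in
/-- RH-FREE. **The pole part is uniformly bounded on the circles `|v| = r_m` (`m ≥ 1`)** — the disc form of «the fast
convergence of the series (piom) to bound `|πω_∞(z)|`» on the contours.
[cite: ConnesConsani2021QuasiInner, Prop 2.4 proof (arXiv chunk p0007:L23)] -/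
theorem norm_poleSum_le_of_norm_eq {m : ℕ} (hm : 1 ≤ m) {v : ℂ} (hv : ‖v‖ = (4 * m + 1) / (4 * m + 5)) :
    ‖∑' n : ℕ, (alphaArch n : ℂ) / (v - xArch n)‖ ≤ ∑' n : ℕ, 8 * (2 * π) ^ (2 * n) / (2 * n)! := by
  have hs : Summable fun n : ℕ => ‖(alphaArch n : ℂ) / (v - xArch n)‖ :=
    Summable.of_nonneg_of_le (fun _ => norm_nonneg _) (norm_alphaArch_div_sub_le hm hv) summable_poleSum_majorant
  exact (norm_tsum_le_tsum_norm hs).trans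
    (Summable.tsum_le_tsum (norm_alphaArch_div_sub_le hm hv) hs summable_poleSum_majorant)


/-! #### Smoothness of the pole part along the circle (`πκ ∈ C^∞(S¹)`) -/

/-- RH-FREE. Iterated derivatives of `x ↦ a·e^{bx}` (`x` real, `a, b` complex). [folklore] -/
private theorem iteratedDeriv_const_mul_cexp (b : ℂ) (k : ℕ) (a : ℂ) :
    iteratedDeriv k (fun x : ℝ => a * Complex.exp (b * x)) = fun x : ℝ => a * b ^ k * Complex.exp (b * x) := by
  induction k generalizing a with
  | zero => funext x; simp
  | succ k ih =>
    rw [iteratedDeriv_succ']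
    have hd : deriv (fun x : ℝ => a * Complex.exp (b * x)) = fun x : ℝ => (a * b) * Complex.exp (b * x) := by
      funext x
      have h1 : HasDerivAt (fun y : ℝ => (b * (y : ℂ))) (b * 1) x := by
        have := (hasDerivAt_id x).ofReal_comp
        simpa using this.const_mul b
      have h2 := (h1.cexp).const_mul a
      rw [h2.deriv]; ring
    rw [hd, ih (a * b)]
    funext x; ring

/-- RH-FREE. `x ↦ a·e^{bx}` is smooth. [folklore] -/
private theorem contDiff_const_mul_cexp (a b : ℂ) :
    ContDiff ℝ (⊤ : ℕ∞) (fun x : ℝ => a * Complex.exp (b * x)) :=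
  contDiff_const.mul (Complex.contDiff_exp.comp (contDiff_const.mul Complex.ofRealCLM.contDiff))

/-- RH-FREE. `‖D^k (a·e^{itx})‖ = ‖a‖ |t|^k` for real `t`. [folklore] -/
private theorem norm_iteratedFDeriv_const_mul_cexp (a : ℂ) (t : ℝ) (k : ℕ) (x : ℝ) :
    ‖iteratedFDeriv ℝ k (fun x : ℝ => a * Complex.exp ((t : ℂ) * I * x)) x‖ = ‖a‖ * |t| ^ k := by
  rw [norm_iteratedFDeriv_eq_norm_iteratedDeriv, iteratedDeriv_const_mul_cexp ((t : ℂ) * I) k a]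
  simp only
  rw [norm_mul, norm_mul, norm_pow, norm_mul, Complex.norm_real, Complex.norm_I, mul_one,
    show ((t : ℂ)) * I * (x : ℂ) = ((t * x : ℝ) : ℂ) * I by push_cast; ring, Complex.norm_exp_ofReal_mul_I,
    mul_one, Real.norm_eq_abs]

open scoped Nat in
/-- RH-FREE. `(j+1)^k ≤ k!·C(j+k,k)`. [folklore] -/
private theorem pow_le_factorial_mul_choose (j k : ℕ) : ((j:ℝ) + 1) ^ k ≤ k ! * ((j + k).choose k : ℝ) := by
  have h := Nat.pow_succ_le_ascFactorial (j + 1) k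
  rw [Nat.ascFactorial_eq_factorial_mul_choose] at h
  exact_mod_cast h

/-- RH-FREE. The geometric expansion of a pole term on the circle: for `|a| < 1` and real `x`,
`α/(e^{2πix} − a) = Σ_j α a^j e^{−2πi(j+1)x}`. [folklore] -/
private theorem hasSum_pole_term (α : ℂ) {a : ℝ} (ha : |a| < 1) (x : ℝ) :
    HasSum (fun j : ℕ => α * (a : ℂ) ^ j * Complex.exp (((-(2 * π * ((j:ℝ) + 1)) : ℝ) : ℂ) * I * x))
      (α / (Complex.exp (2 * π * I * x) - a)) := by
  set w : ℂ := Complex.exp (2 * π * I * x) with hw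
  have hw1 : ‖w‖ = 1 := by
    rw [hw, show (2 * π * I * x : ℂ) = ((2 * π * x : ℝ) : ℂ) * I by push_cast; ring]
    exact Complex.norm_exp_ofReal_mul_I _
  have hw0 : w ≠ 0 := by rw [hw]; exact Complex.exp_ne_zero _
  set r : ℂ := (a : ℂ) * w⁻¹ with hr
  have hr1 : ‖r‖ < 1 := by
    rw [hr, norm_mul, norm_inv, hw1, inv_one, mul_one, Complex.norm_real, Real.norm_eq_abs]; exact ha
  have hgeom := hasSum_geometric_of_norm_lt_one hr1
  have h2 := hgeom.mul_left (α * w⁻¹)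
  have hne : w - a ≠ 0 := by
    intro h
    have : ‖w‖ = ‖(a:ℂ)‖ := by rw [sub_eq_zero.mp h]
    rw [hw1, Complex.norm_real, Real.norm_eq_abs] at this
    linarith
  have hval : α * w⁻¹ * (1 - r)⁻¹ = α / (w - a) := by
    have e1 : (1:ℂ) - r = (w - a) / w := by rw [hr]; field_simp
    rw [e1, inv_div]
    field_simp
  rw [hval] at h2
  refine h2.congr_fun fun j => ?_
  have hexp : Complex.exp (((-(2 * π * ((j:ℝ) + 1)) : ℝ) : ℂ) * I * x) = (w⁻¹) ^ (j + 1) := by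
    rw [hw, ← Complex.exp_neg, ← Complex.exp_nat_mul]
    congr 1
    push_cast
    ring
  rw [hexp, hr, mul_pow, pow_succ]
  ring

/-- RH-FREE. `|x(n)| ≤ 1 − 2/(4n+3)`. [cite: ConnesConsani2021QuasiInner, §2 «1 − x(n) ∼ 1/n» (arXiv chunk p0005:L122)] -/
theorem abs_xArch_le (n : ℕ) : |xArch n| ≤ 1 - 2 / (4 * (n:ℝ) + 3) := by
  have h43 : (0:ℝ) < 4 * n + 3 := by positivity
  rcases Nat.eq_zero_or_pos n with rfl | hn
  · norm_num [xArch]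
  · have hn1 : (1:ℝ) ≤ n := by exact_mod_cast hn
    have hx : 0 ≤ xArch n := by
      rw [xArch]
      have : (4:ℝ) / (4 * n + 3) ≤ 1 := by rw [div_le_one h43]; linarith
      linarith
    rw [abs_of_nonneg hx, xArch]
    have : (2:ℝ) / (4 * n + 3) ≤ 4 / (4 * n + 3) := by gcongr; norm_num
    linarith

open scoped Nat in
/-- RH-FREE. **Bound on the iterated derivatives of one pole term along the circle**:
`‖D^k(x ↦ α(n)/(e^{2πix} − x(n)))‖ ≤ |α(n)| (2π)^k k! / (1 − |x(n)|)^{k+1}` — the termwise estimate behind the printed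
«series of m-th derivatives of the terms … is absolutely convergent» (print applies `(v∂_v)^m` to the rational term;
here: geometric expansion `Σ_j α x^j e^{−2πi(j+1)θ}` and `Σ_j (j+1)^k y^j ≤ k!/(1−y)^{k+1}`).
[cite: ConnesConsani2021QuasiInner, Prop 2.4 proof (arXiv chunk p0006:L104–p0007:L8)] -/
theorem norm_iteratedFDeriv_poleTerm_le (n k : ℕ) (x : ℝ) :
    ‖iteratedFDeriv ℝ k (fun x : ℝ => (alphaArch n : ℂ) / (Complex.exp (2 * π * I * x) - xArch n)) x‖ ≤
      |alphaArch n| * (2 * π) ^ k * k ! / (1 - |xArch n|) ^ (k + 1) := by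
  have hxn := xArch_lt_one n
  have hnorm : ‖(|xArch n| : ℝ)‖ < 1 := by rwa [Real.norm_eq_abs, abs_abs]
  set g : ℕ → ℝ → ℂ := fun j x => ((alphaArch n : ℂ) * (xArch n : ℂ) ^ j) *
    Complex.exp (((-(2 * π * ((j:ℝ) + 1)) : ℝ) : ℂ) * I * x) with hg
  have hfun : (fun x : ℝ => (alphaArch n : ℂ) / (Complex.exp (2 * π * I * x) - xArch n)) =
      fun x => ∑' j, g j x := by
    funext x
    exact ((hasSum_pole_term (alphaArch n : ℂ) hxn x).tsum_eq).symm
  set v : ℕ → ℕ → ℝ := fun k j => (|alphaArch n| * |xArch n| ^ j) * (2 * π * ((j:ℝ) + 1)) ^ k with hv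
  have hg_smooth : ∀ j, ContDiff ℝ (⊤ : ℕ∞) (g j) := fun j =>
    contDiff_const_mul_cexp ((alphaArch n : ℂ) * (xArch n : ℂ) ^ j) ((((-(2 * π * ((j:ℝ) + 1)) : ℝ) : ℂ)) * I)
  have hg_norm : ∀ k j x, ‖iteratedFDeriv ℝ k (g j) x‖ = v k j := by
    intro k j x
    simp only [hg, hv]
    rw [norm_iteratedFDeriv_const_mul_cexp, norm_mul, Complex.norm_real, norm_pow, Complex.norm_real,
      Real.norm_eq_abs, Real.norm_eq_abs, abs_neg,
      abs_of_pos (show (0:ℝ) < 2 * π * ((j:ℝ) + 1) by positivity)]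
  have hmaj : ∀ k, Summable fun j : ℕ =>
      |alphaArch n| * (2 * π) ^ k * k ! * (((j + k).choose k : ℝ) * |xArch n| ^ j) := fun k =>
    (summable_choose_mul_geometric_of_norm_lt_one k hnorm).mul_left _
  have hle : ∀ k j, v k j ≤ |alphaArch n| * (2 * π) ^ k * k ! * (((j + k).choose k : ℝ) * |xArch n| ^ j) := by
    intro k j
    have := pow_le_factorial_mul_choose j k
    calc v k j = |alphaArch n| * (2 * π) ^ k * ((j:ℝ) + 1) ^ k * |xArch n| ^ j := by
          simp only [hv]; rw [mul_pow]; ring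
      _ ≤ |alphaArch n| * (2 * π) ^ k * (k ! * ((j + k).choose k : ℝ)) * |xArch n| ^ j := by gcongr
      _ = _ := by ring
  have hv_sum : ∀ k, Summable (v k) := fun k =>
    Summable.of_nonneg_of_le (fun j => by positivity) (hle k) (hmaj k)
  have hD := iteratedFDeriv_tsum (f := g) (v := v) (N := ⊤) hg_smooth (fun k _ => hv_sum k)
    (fun k j x _ => (hg_norm k j x).le) (k := k) le_top
  rw [hfun, hD]
  have hs : Summable fun j => ‖iteratedFDeriv ℝ k (g j) x‖ := (hv_sum k).congr fun j => (hg_norm k j x).symm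
  calc ‖∑' j, iteratedFDeriv ℝ k (g j) x‖ ≤ ∑' j, ‖iteratedFDeriv ℝ k (g j) x‖ := norm_tsum_le_tsum_norm hs
    _ = ∑' j, v k j := tsum_congr fun j => hg_norm k j x
    _ ≤ ∑' j, |alphaArch n| * (2 * π) ^ k * k ! * (((j + k).choose k : ℝ) * |xArch n| ^ j) :=
        Summable.tsum_le_tsum (hle k) (hv_sum k) (hmaj k)
    _ = |alphaArch n| * (2 * π) ^ k * k ! * ∑' j : ℕ, (((j + k).choose k : ℝ) * |xArch n| ^ j) :=
        tsum_mul_left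
    _ = |alphaArch n| * (2 * π) ^ k * k ! * (1 / (1 - |xArch n|) ^ (k + 1)) := by
        rw [tsum_choose_mul_geometric_of_norm_lt_one k hnorm]
    _ = |alphaArch n| * (2 * π) ^ k * ↑k ! / (1 - |xArch n|) ^ (k + 1) := by ring

open scoped Nat in
/-- RH-FREE. `Σ_n |α(n)|(4n+3)^p < ∞` for every `p` («the series α(n) is summable and tends to 0 extremely fast, while …
1 − x(n) ∼ 1/n»). [cite: ConnesConsani2021QuasiInner, §2 (arXiv chunk p0005:L122)] -/
theorem summable_abs_alphaArch_mul_pow (p : ℕ) : Summable fun n : ℕ => |alphaArch n| * (4 * (n:ℝ) + 3) ^ p := by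
  have hgeo : Summable fun n : ℕ => (((n + 1 : ℕ) : ℝ)) ^ p * (1 / 2 : ℝ) ^ (n + 1) := by
    have h := summable_pow_mul_geometric_of_norm_lt_one p
      (show ‖(1 / 2 : ℝ)‖ < 1 by rw [Real.norm_eq_abs, abs_of_pos (by norm_num)]; norm_num)
    exact h.comp_injective Nat.succ_injective
  set C : ℝ := 16 * Real.exp (8 * π ^ 2) * 7 ^ p * 2 with hC
  refine Summable.of_nonneg_of_le (fun n => by positivity) (fun n => ?_) (hgeo.mul_left C)
  rw [abs_alphaArch]
  have hfac : ((n ! : ℕ) : ℝ) ≤ (2 * n)! := by exact_mod_cast Nat.factorial_le (by omega)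
  have hfac0 : (0:ℝ) < n ! := by positivity
  have hexp : (8 * π ^ 2) ^ n / n ! ≤ Real.exp (8 * π ^ 2) := Real.pow_div_factorial_le_exp _ (by positivity) n
  have h43 : (4 * (n:ℝ) + 3) ^ p ≤ 7 ^ p * ((n + 1 : ℕ) : ℝ) ^ p := by
    rw [← mul_pow]; apply pow_le_pow_left₀ (by positivity); push_cast; linarith
  have hpow : (2 * π) ^ (2 * n) = (8 * π ^ 2) ^ n * (1 / 2 : ℝ) ^ n := by
    rw [← mul_pow, pow_mul]; congr 1; ring
  have hsq : (1:ℝ) ≤ (4 * n + 3) ^ 2 := by nlinarith [n.cast_nonneg (α := ℝ)]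
  have hA : (8 * π ^ 2) ^ n / (2 * n)! ≤ Real.exp (8 * π ^ 2) :=
    (div_le_div_of_nonneg_left (by positivity) hfac0 hfac).trans hexp
  calc 16 * (2 * π) ^ (2 * n) / ((2 * n)! * (4 * (n:ℝ) + 3) ^ 2) * (4 * (n:ℝ) + 3) ^ p
      = 16 * ((2 * π) ^ (2 * n) / (2 * n)!) * ((4 * (n:ℝ) + 3) ^ p / (4 * (n:ℝ) + 3) ^ 2) := by
        field_simp
    _ ≤ 16 * ((2 * π) ^ (2 * n) / (2 * n)!) * ((4 * (n:ℝ) + 3) ^ p / 1) := by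
        gcongr
    _ = 16 * ((8 * π ^ 2) ^ n / (2 * n)!) * (1 / 2 : ℝ) ^ n * (4 * (n:ℝ) + 3) ^ p := by
        rw [hpow]; ring
    _ ≤ 16 * Real.exp (8 * π ^ 2) * (1 / 2 : ℝ) ^ n * (7 ^ p * ((n + 1 : ℕ) : ℝ) ^ p) := by
        gcongr
    _ = C * ((((n + 1 : ℕ) : ℝ)) ^ p * (1 / 2 : ℝ) ^ (n + 1)) := by
        rw [hC, pow_succ]; ring

open scoped Nat in
/-- RH-FREE. **The pole part restricted to the circle, `c(x) = Σ_n α(n)/(e^{2πix} − x(n))`, is `C^∞`** — the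
`C^∞(S¹)` half of Prop. 2.4: «the series of m-th derivatives of the terms in the sum (pikap) … is absolutely
convergent and hence πκ(e^{iθ}) is a smooth periodic complex valued function» (termwise bounds summed with
`Σ_n |α(n)|(4n+3)^{k+1} < ∞`).
[cite: ConnesConsani2021QuasiInner, Prop 2.4 proof (arXiv chunk p0006:L104–p0007:L8)] -/
theorem contDiff_poleSum_circle :
    ContDiff ℝ (⊤ : ℕ∞) (fun x : ℝ => ∑' n : ℕ, (alphaArch n : ℂ) / (Complex.exp (2 * π * I * x) - xArch n)) := by
  refine contDiff_tsum (N := ⊤)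
    (v := fun k n => |alphaArch n| * (2 * π) ^ k * k ! * ((4 * (n:ℝ) + 3) / 2) ^ (k + 1))
    (fun n => ?_) (fun k _ => ?_) (fun k n x _ => ?_)
  · have hne : ∀ x : ℝ, Complex.exp (2 * π * I * x) - xArch n ≠ 0 := by
      intro x h
      have h1 : ‖Complex.exp (2 * π * I * x)‖ = 1 := by
        rw [show (2 * π * I * x : ℂ) = ((2 * π * x : ℝ) : ℂ) * I by push_cast; ring]
        exact Complex.norm_exp_ofReal_mul_I _
      rw [sub_eq_zero.mp h, Complex.norm_real, Real.norm_eq_abs] at h1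
      have := xArch_lt_one n
      linarith
    have h1 : ContDiff ℝ (⊤ : ℕ∞) (fun x : ℝ => Complex.exp (2 * π * I * x) - xArch n) :=
      (Complex.contDiff_exp.comp (contDiff_const.mul Complex.ofRealCLM.contDiff)).sub contDiff_const
    simp_rw [div_eq_mul_inv]
    exact contDiff_const.mul (h1.inv hne)
  · have := (summable_abs_alphaArch_mul_pow (k + 1)).mul_left ((2 * π) ^ k * k ! / 2 ^ (k + 1))
    refine this.congr fun n => ?_
    rw [div_pow]
    ring
  · have h := norm_iteratedFDeriv_poleTerm_le n k x
    have h43 : (0:ℝ) < 4 * n + 3 := by positivity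
    have h1x : 2 / (4 * (n:ℝ) + 3) ≤ 1 - |xArch n| := by have := abs_xArch_le n; linarith
    have h2 : (0:ℝ) < 2 / (4 * n + 3) := by positivity
    refine h.trans ?_
    rw [div_eq_mul_one_div]
    gcongr
    rw [one_div, ← inv_pow, show (4 * (n:ℝ) + 3) / 2 = (2 / (4 * (n:ℝ) + 3))⁻¹ by rw [inv_div]]
    exact pow_le_pow_left₀ (inv_nonneg.mpr (by linarith)) (inv_anti₀ h2 h1x) _

/-- RH-FREE. The pole part along the circle is `1`-periodic. [cite: ConnesConsani2021QuasiInner, Prop 2.4 proof «smooth periodic» (arXiv chunk p0007:L8)] -/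
theorem periodic_poleSum_circle :
    Function.Periodic (fun x : ℝ => ∑' n : ℕ, (alphaArch n : ℂ) / (Complex.exp (2 * π * I * x) - xArch n)) 1 := by
  intro x
  have : Complex.exp (2 * π * I * ((x + 1 : ℝ) : ℂ)) = Complex.exp (2 * π * I * x) := by
    push_cast
    rw [mul_add, mul_one, Complex.exp_add, Complex.exp_two_pi_mul_I, mul_one]
  simp only [this]

/-! #### The pole part on the disc: finite part + holomorphic tail; the regularised remainder `h = κ − G` -/

/-- RH-FREE. `x(n)` is strictly increasing («the x(n) increase to 1»).
[cite: ConnesConsani2021QuasiInner, §2 (arXiv chunk p0005:L122)] -/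
theorem xArch_strictMono : StrictMono xArch := by
  intro a b hab
  simp only [xArch]
  have ha : (0:ℝ) < 4 * a + 3 := by positivity
  have hab' : (a:ℝ) < b := by exact_mod_cast hab
  have : (4:ℝ) / (4 * b + 3) < 4 / (4 * a + 3) := by
    apply div_lt_div_of_pos_left (by norm_num) ha; linarith
  linarith

/-- RH-FREE. `n ↦ x(n)` is injective. [cite: ConnesConsani2021QuasiInner, §2 (arXiv chunk p0005:L122)] -/
theorem xArch_injective : Function.Injective xArch := xArch_strictMono.injective

/-- RH-FREE. On the closed disc `‖v‖ ≤ r_m` the tail terms `n > m` of the pole part are uniformly small: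
`‖α(n)/(v − x(n))‖ ≤ |α(n)|/(x(m+1) − r_m)`. [cite: ConnesConsani2021QuasiInner, Prop 2.4 proof (arXiv chunk p0006:L91–L104)] -/
theorem norm_poleTailTerm_le (m n : ℕ) {v : ℂ} (hv : ‖v‖ ≤ (4 * m + 1) / (4 * m + 5)) :
    ‖(alphaArch (n + (m + 1)) : ℂ) / (v - xArch (n + (m + 1)))‖ ≤
      |alphaArch (n + (m + 1))| / (xArch (m + 1) - (4 * m + 1) / (4 * m + 5)) := by
  have hδ : (0:ℝ) < xArch (m + 1) - (4 * m + 1) / (4 * m + 5) := by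
    have := rArch_lt_xArch (show m < m + 1 by omega); linarith
  have hmono : xArch (m + 1) ≤ xArch (n + (m + 1)) := xArch_strictMono.monotone (by omega)
  have hden : xArch (m + 1) - (4 * m + 1) / (4 * m + 5) ≤ ‖v - xArch (n + (m + 1))‖ := by
    have h1 : ‖(xArch (n + (m + 1)) : ℂ)‖ - ‖v‖ ≤ ‖v - xArch (n + (m + 1))‖ := by
      rw [← norm_neg (v - _), neg_sub]; exact norm_sub_norm_le _ _
    have h2 : xArch (n + (m + 1)) ≤ ‖(xArch (n + (m + 1)) : ℂ)‖ := by
      rw [Complex.norm_real, Real.norm_eq_abs]; exact le_abs_self _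
    linarith
  rw [norm_div, Complex.norm_real, Real.norm_eq_abs]
  exact div_le_div_of_nonneg_left (abs_nonneg _) hδ hden

/-- RH-FREE. The summable majorant of the tail on `‖v‖ ≤ r_m`. [folklore] -/
private theorem summable_poleTail_majorant (m : ℕ) :
    Summable fun n : ℕ => |alphaArch (n + (m + 1))| / (xArch (m + 1) - (4 * m + 1) / (4 * m + 5)) :=
  ((summable_nat_add_iff (m + 1)).mpr summable_abs_alphaArch).div_const _

/-- RH-FREE. The tail of the pole series converges on `‖v‖ ≤ r_m`. [folklore] -/
private theorem summable_poleTail (m : ℕ) {v : ℂ} (hv : ‖v‖ ≤ (4 * m + 1) / (4 * m + 5)) :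
    Summable fun n : ℕ => (alphaArch (n + (m + 1)) : ℂ) / (v - xArch (n + (m + 1))) :=
  Summable.of_norm_bounded (summable_poleTail_majorant m) fun n => norm_poleTailTerm_le m n hv

/-- RH-FREE. **The tail `Σ_{n>m} α(n)/(v − x(n))` of the pole part is holomorphic on the disc `‖v‖ < r_m`**
(`r_m = ψ⁻¹(−2m−1)` separates `x(m) < r_m < x(m+1)`; uniform convergence by `Σ|α(n)| < ∞`).
[cite: ConnesConsani2021QuasiInner, Prop 2.4 proof (arXiv chunk p0006:L91–L104)] -/
theorem differentiableOn_poleTail (m : ℕ) :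
    DifferentiableOn ℂ (fun v : ℂ => ∑' n : ℕ, (alphaArch (n + (m + 1)) : ℂ) / (v - xArch (n + (m + 1))))
      (ball 0 ((4 * m + 1) / (4 * m + 5))) := by
  refine differentiableOn_tsum_of_summable_norm (u := fun n => |alphaArch (n + (m + 1))| /
      (xArch (m + 1) - (4 * m + 1) / (4 * m + 5))) (summable_poleTail_majorant m) (fun n => ?_) isOpen_ball
    (fun n v hv => norm_poleTailTerm_le m n (le_of_lt (mem_ball_zero_iff.mp hv)))
  apply DifferentiableOn.div (differentiableOn_const _) (differentiableOn_id.sub (differentiableOn_const _))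
  intro v hv h0
  have hv' := mem_ball_zero_iff.mp hv
  have := rArch_lt_xArch (show m < n + (m + 1) by omega)
  rw [sub_eq_zero.mp h0, Complex.norm_real, Real.norm_eq_abs] at hv'
  linarith [le_abs_self (xArch (n + (m + 1)))]

/-- RH-FREE. The pole series converges at every point of the open unit disc (at a pole the offending term is
`α/0 = 0` by convention). [cite: ConnesConsani2021QuasiInner, Prop 2.4 proof (arXiv chunk p0006:L91–L104)] -/
theorem summable_poleSum_of_norm_lt_one {v : ℂ} (hv : ‖v‖ < 1) :
    Summable fun n : ℕ => (alphaArch n : ℂ) / (v - xArch n) := by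
  obtain ⟨m, hm⟩ := (tendsto_rArch.eventually (eventually_gt_nhds hv)).exists
  exact (summable_nat_add_iff (f := fun n => (alphaArch n : ℂ) / (v - xArch n)) (m + 1)).mp
    (summable_poleTail m hm.le)

/-- RH-FREE. Finite part + tail: `G(v) = Σ_{n≤m} α(n)/(v − x(n)) + Σ_{n>m} α(n)/(v − x(n))` on `‖v‖ ≤ r_m`.
[cite: ConnesConsani2021QuasiInner, Prop 2.4 proof (arXiv chunk p0006:L91–L104)] -/
theorem poleSum_eq_sum_add_tail (m : ℕ) {v : ℂ} (hv : ‖v‖ ≤ (4 * m + 1) / (4 * m + 5)) :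
    ∑' n : ℕ, (alphaArch n : ℂ) / (v - xArch n) =
      ∑ n ∈ Finset.range (m + 1), (alphaArch n : ℂ) / (v - xArch n) +
        ∑' n : ℕ, (alphaArch (n + (m + 1)) : ℂ) / (v - xArch (n + (m + 1))) :=
  (Summable.sum_add_tsum_nat_add' (f := fun n => (alphaArch n : ℂ) / (v - xArch n)) (k := m + 1)
    (summable_poleTail m hv)).symm

/-- RH-FREE. Each pole `x(j)` is isolated in the singular set `{x(n)} ∪ {1}`.
[cite: ConnesConsani2021QuasiInner, §2 (arXiv chunk p0005:L122)] -/
theorem eventually_notMem_polesArch (j : ℕ) :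
    ∀ᶠ v in 𝓝[≠] (xArch j : ℂ), v ∉ insert (1:ℂ) (Set.range fun n : ℕ => (xArch n : ℂ)) := by
  have hr1 := rArch_lt_one (j + 1)
  have hxj : ‖(xArch j : ℂ)‖ < (4 * ↑(j + 1) + 1) / (4 * ↑(j + 1) + 5) := by
    rw [Complex.norm_real, Real.norm_eq_abs]; exact abs_xArch_lt_rArch (by omega) (by omega)
  set F : Set ℂ := (fun n : ℕ => (xArch n : ℂ)) '' (Finset.range (j + 2) : Set ℕ) with hF
  have hFfin : F.Finite := (Finset.finite_toSet _).image _
  have hcl : (F \ {(xArch j : ℂ)})ᶜ ∈ 𝓝 (xArch j : ℂ) :=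
    (hFfin.subset fun x hx => hx.1).isClosed.isOpen_compl.mem_nhds (by simp)
  filter_upwards [mem_nhdsWithin_of_mem_nhds (isOpen_ball.mem_nhds (mem_ball_zero_iff.mpr hxj)),
    mem_nhdsWithin_of_mem_nhds hcl, self_mem_nhdsWithin] with v hv hvF hvj
  rw [mem_ball_zero_iff] at hv
  rintro (h1 | ⟨n, hn⟩)
  · rw [h1, norm_one] at hv; linarith
  · rcases le_or_gt n (j + 1) with h | h
    · exact hvF ⟨⟨n, Finset.mem_coe.mpr (Finset.mem_range.mpr (by omega)), hn⟩, hvj⟩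
    · have := rArch_lt_xArch h
      rw [← hn, Complex.norm_real, Real.norm_eq_abs] at hv
      linarith [le_abs_self (xArch n)]

/-- RH-FREE. Unpacking `v ∉ {1} ∪ {x(n)}`. [folklore] -/
private theorem not_mem_polesArch {v : ℂ} (hv : v ∉ insert (1:ℂ) (Set.range fun n : ℕ => (xArch n : ℂ))) :
    v ≠ 1 ∧ ∀ n : ℕ, v ≠ xArch n :=
  ⟨fun h => hv (h ▸ Set.mem_insert _ _), fun n h => hv (Set.mem_insert_of_mem _ ⟨n, h.symm⟩)⟩

/-- RH-FREE. `κ − G` is holomorphic off the singular set. [cite: ConnesConsani2021QuasiInner, Prop 2.4 proof «k … by construction holomorphic in 𝒰» (arXiv chunk p0007:L8–L23)] -/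
theorem differentiableAt_kappaArch_sub_poleSum {v : ℂ}
    (hv : v ∉ insert (1:ℂ) (Set.range fun n : ℕ => (xArch n : ℂ))) :
    DifferentiableAt ℂ (fun v : ℂ => kappaArch v - ∑' n : ℕ, (alphaArch n : ℂ) / (v - xArch n)) v :=
  (differentiableAt_kappaArch (not_mem_polesArch hv).1 (not_mem_polesArch hv).2).sub (differentiableAt_poleSum hv)

/-- RH-FREE. **`κ − G` has a removable singularity at each pole `x(j)`** (the pole parts cancel:
`κ(v) − α(j)/(v − x(j)) → L` and the other terms are continuous at `x(j)`).
[cite: ConnesConsani2021QuasiInner, Prop 2.4 proof (arXiv chunk p0006:L91–p0007:L23)] -/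
theorem exists_tendsto_kappaArch_sub_poleSum (j : ℕ) :
    ∃ L : ℂ, Tendsto (fun v : ℂ => kappaArch v - ∑' n : ℕ, (alphaArch n : ℂ) / (v - xArch n))
      (𝓝[≠] (xArch j : ℂ)) (𝓝 L) := by
  have hxj : ‖(xArch j : ℂ)‖ < (4 * ↑(j + 1) + 1) / (4 * ↑(j + 1) + 5) := by
    rw [Complex.norm_real, Real.norm_eq_abs]; exact abs_xArch_lt_rArch (by omega) (by omega)
  obtain ⟨L₁, hL₁⟩ := exists_tendsto_kappaArch_sub_pole j
  set R : Finset ℕ := Finset.range (j + 1 + 1) with hR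
  have hjR : j ∈ R := Finset.mem_range.mpr (by omega)
  set Q : ℂ → ℂ := fun v => ∑ n ∈ R.erase j, (alphaArch n : ℂ) / (v - xArch n) with hQ
  set Tl : ℂ → ℂ := fun v => ∑' n : ℕ, (alphaArch (n + (j + 1 + 1)) : ℂ) / (v - xArch (n + (j + 1 + 1)))
    with hTl
  have hQcont : ContinuousAt Q (xArch j : ℂ) := by
    have : DifferentiableAt ℂ Q (xArch j : ℂ) := by
      simp only [hQ]
      apply DifferentiableAt.fun_sum
      intro n hn
      have hne : n ≠ j := (Finset.mem_erase.mp hn).1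
      have hx : (xArch j : ℂ) ≠ xArch n := fun h => hne (xArch_injective (by exact_mod_cast h)).symm
      exact (differentiableAt_const _).div (differentiableAt_id.sub (differentiableAt_const _)) (sub_ne_zero.mpr hx)
    exact this.continuousAt
  have hTcont : ContinuousAt Tl (xArch j : ℂ) :=
    ((differentiableOn_poleTail (j + 1)).differentiableAt
      (isOpen_ball.mem_nhds (mem_ball_zero_iff.mpr hxj))).continuousAt
  refine ⟨L₁ - Q (xArch j) - Tl (xArch j), ?_⟩
  have hlim := (hL₁.sub (hQcont.tendsto.mono_left nhdsWithin_le_nhds)).sub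
    (hTcont.tendsto.mono_left nhdsWithin_le_nhds)
  refine hlim.congr' ?_
  filter_upwards [mem_nhdsWithin_of_mem_nhds (isOpen_ball.mem_nhds (mem_ball_zero_iff.mpr hxj))] with v hv
  have hv' := (mem_ball_zero_iff.mp hv).le
  simp only [hQ, hTl]
  rw [poleSum_eq_sum_add_tail (j + 1) hv',
    ← Finset.add_sum_erase R (fun n => (alphaArch n : ℂ) / (v - xArch n)) hjR]
  ring

/-- RH-FREE. **Connes–Consani JNT 2021 Proposition 2.4 — DISCHARGED: `κ ∈ C^∞(S¹) + H^∞(𝒰)`.**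
With `c(x) := Σ_n α(n)/(e^{2πix} − x(n))` (the pole part `πκ` of the print up to an additive constant, smooth and
`1`-periodic by `contDiff_poleSum_circle`) and `h := κ − Σ_n α(n)/(v − x(n))` regularised at the poles (holomorphic in
the disc by removable singularities; bounded by the maximum modulus principle on the discs `‖v‖ ≤ r_m`, where `κ` and
the pole part are bounded uniformly in `m` — `exists_bound_kappaArch_circle`, `norm_poleSum_le_of_norm_eq` — the disc
form of the printed contour estimates on `C_{R,m}`; print instead goes through `b_{−k} = a_{−k}`, `H²` and the Cauchy
integral, [Rudin] 17.11/17.12), the radial limits `h(r e^{2πix}) → κ(e^{2πix}) − c(x)` hold at every `x ∉ ℤ` by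
continuity. [cite: ConnesConsani2021QuasiInner, Prop 2.4 + proof (arXiv chunk p0006:L87–p0007:L23)] -/
theorem prop_2_4_holds : prop_2_4 := by
  classical
  set T : Set ℂ := Set.range (fun n : ℕ => (xArch n : ℂ)) with hT
  set S : Set ℂ := insert (1:ℂ) T with hS
  have hSc : IsClosed S := isClosed_insert_one_range_xArch
  set G : ℂ → ℂ := fun v => ∑' n : ℕ, (alphaArch n : ℂ) / (v - xArch n) with hG
  set H₀ : ℂ → ℂ := fun v => kappaArch v - G v with hH₀
  set h : ℂ → ℂ := T.piecewise (fun v => limUnder (𝓝[≠] v) H₀) H₀ with hh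
  set c : ℝ → ℂ := fun x => G (Complex.exp (2 * π * I * x)) with hc
  -- `h = H₀` near every point off `S`, where `H₀` is holomorphic
  have h_eq : ∀ v, v ∉ S → h =ᶠ[𝓝 v] H₀ := by
    intro v hv
    filter_upwards [hSc.isOpen_compl.mem_nhds hv] with u hu
    exact Set.piecewise_eq_of_notMem _ _ _ fun huT => hu (Set.mem_insert_of_mem _ huT)
  have hH₀diff : ∀ v, v ∉ S → DifferentiableAt ℂ H₀ v := fun v hv =>
    differentiableAt_kappaArch_sub_poleSum hv
  -- (iii) `h` is holomorphic in the open unit disc (removable singularities at the poles)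
  have hdiff : DifferentiableOn ℂ h (ball 0 1) := by
    intro v hv
    rw [mem_ball_zero_iff] at hv
    apply DifferentiableAt.differentiableWithinAt
    by_cases hvT : v ∈ T
    · obtain ⟨j, rfl⟩ := hvT
      obtain ⟨L, hL⟩ := exists_tendsto_kappaArch_sub_poleSum j
      have hiso := eventually_notMem_polesArch j
      have hev : ∀ᶠ u in 𝓝[≠] (xArch j : ℂ), h u = H₀ u :=
        hiso.mono fun u hu => Set.piecewise_eq_of_notMem _ _ _ fun huT => hu (Set.mem_insert_of_mem _ huT)
      have hhx : h (xArch j) = L := by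
        rw [hh, Set.piecewise_eq_of_mem _ _ _ (show (xArch j : ℂ) ∈ T from ⟨j, rfl⟩)]; exact hL.limUnder_eq
      have hcont : ContinuousAt h (xArch j) := by
        rw [← continuousWithinAt_compl_self, ContinuousWithinAt, hhx]
        exact hL.congr' (hev.mono fun u hu => hu.symm)
      have hd : ∀ᶠ u in 𝓝[≠] (xArch j : ℂ), DifferentiableAt ℂ h u :=
        hiso.mono fun u hu => (hH₀diff u hu).congr_of_eventuallyEq (h_eq u hu)
      exact (Complex.analyticAt_of_differentiable_on_punctured_nhds_of_continuousAt hd hcont).differentiableAt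
    · have hvS : v ∉ S := by
        rintro (h1 | h2)
        · rw [h1, norm_one] at hv; exact lt_irrefl _ hv
        · exact hvT h2
      exact (hH₀diff v hvS).congr_of_eventuallyEq (h_eq v hvS)
  refine ⟨c, h, contDiff_poleSum_circle, periodic_poleSum_circle, hdiff, ?_, ?_⟩
  · -- (iv) `h` is bounded: maximum modulus on the discs `‖v‖ ≤ r_m`, uniform bounds on the circles
    obtain ⟨C₁, -, hC₁⟩ := exists_bound_kappaArch_circle
    refine ⟨C₁ + ∑' n : ℕ, 8 * (2 * π) ^ (2 * n) / ((2 * n).factorial : ℝ), fun v hv => ?_⟩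
    rw [mem_ball_zero_iff] at hv
    obtain ⟨m, hvm, hm1⟩ := ((tendsto_rArch.eventually (eventually_gt_nhds hv)).and
      (eventually_ge_atTop 1)).exists
    have hr0 := rArch_pos m
    have hr1 := rArch_lt_one m
    have hcl : closure (ball (0:ℂ) ((4 * m + 1) / (4 * m + 5))) ⊆ ball 0 1 :=
      closure_ball_subset_closedBall.trans (closedBall_subset_ball hr1)
    have hd : DiffContOnCl ℂ h (ball (0:ℂ) ((4 * m + 1) / (4 * m + 5))) := (hdiff.mono hcl).diffContOnCl
    refine Complex.norm_le_of_forall_mem_frontier_norm_le isBounded_ball hd (fun z hz => ?_)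
      (subset_closure (mem_ball_zero_iff.mpr hvm))
    rw [frontier_ball _ hr0.ne', mem_sphere_zero_iff_norm] at hz
    have hzT : z ∉ T := fun ⟨n, hn⟩ => ne_xArch_of_norm_eq hm1 hz n hn.symm
    rw [hh, Set.piecewise_eq_of_notMem _ _ _ hzT]
    exact (norm_sub_le _ _).trans (add_le_add (hC₁ m hm1 z hz) (norm_poleSum_le_of_norm_eq hm1 hz))
  · -- (v) radial boundary values at every `x ∉ ℤ` (a null set), by continuity of `κ − G` at `e^{2πix} ≠ 1`
    have hae : ∀ᵐ x : ℝ, x ∉ Set.range (Int.cast : ℤ → ℝ) :=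
      measure_eq_zero_iff_ae_notMem.mp ((Set.countable_range _).measure_zero _)
    filter_upwards [hae] with x hx
    set w : ℂ := Complex.exp (2 * π * I * x) with hw
    have hwS : w ∉ S := by
      rintro (h1 | ⟨n, hn⟩)
      · rw [hw] at h1
        obtain ⟨k, hk⟩ := Complex.exp_eq_one_iff.mp h1
        apply hx
        refine ⟨k, ?_⟩
        have h2 : (2 * π * I : ℂ) ≠ 0 := by simp [Real.pi_ne_zero, Complex.I_ne_zero]
        have h3 : (x : ℂ) * (2 * π * I) = (k : ℂ) * (2 * π * I) := by rw [← hk]; ring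
        have h4 := mul_right_cancel₀ h2 h3
        exact_mod_cast h4.symm
      · have h1 : ‖w‖ = 1 := by
          rw [hw, show (2 * π * I * x : ℂ) = ((2 * π * x : ℝ) : ℂ) * I by push_cast; ring]
          exact Complex.norm_exp_ofReal_mul_I _
        rw [← hn, Complex.norm_real, Real.norm_eq_abs] at h1
        have := xArch_lt_one n
        linarith
    have hcont : ContinuousAt H₀ w := (hH₀diff w hwS).continuousAt
    have hpath : Tendsto (fun r : ℝ => (r : ℂ) * w) (𝓝[<] (1:ℝ)) (𝓝 w) := by
      have h0 : Continuous fun r : ℝ => (r : ℂ) * w := Complex.continuous_ofReal.mul continuous_const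
      have h1 := h0.tendsto 1
      simp only [Complex.ofReal_one, one_mul] at h1
      exact h1.mono_left nhdsWithin_le_nhds
    have hlim : Tendsto (fun r : ℝ => H₀ ((r : ℂ) * w)) (𝓝[<] (1:ℝ)) (𝓝 (H₀ w)) :=
      hcont.tendsto.comp hpath
    have hev : ∀ᶠ r : ℝ in 𝓝[<] (1:ℝ), h ((r : ℂ) * w) = H₀ ((r : ℂ) * w) := by
      filter_upwards [hpath.eventually (hSc.isOpen_compl.eventually_mem hwS)] with r hr
      exact Set.piecewise_eq_of_notMem _ _ _ fun h' => hr (Set.mem_insert_of_mem _ h')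
    have hval : H₀ w = kappaArch w - c x := rfl
    rw [hval] at hlim
    exact hlim.congr' (hev.mono fun r hr => hr.symm)

end QuasiInner

end Literature.NumberTheory.ConnesConsani2021
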